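import Literature.NumberTheory.Sieve.PairLinearFormSieve
import Literature.NumberTheory.Sieve.LandreauInequality
import Literature.NumberTheory.Sieve.RoughDivisorPowerSums
import Literature.NumberTheory.Sieve.DivisorPowerSums
import HarnessLib

/-!
# Divisor powers along a pair of linear forms over rough numbers (Matomäki–Merikoski Lemma 3.1(i), coarse form)

Topic `Literature/NumberTheory/Sieve`.  Everything in this file is PROVED.  For coprime `m, h ≥ 1` of size
`≤ x^B`, sieving levels `2 ≤ w₁, w₂ ≤ x` and exponents `a, b`, writing `N = mn + h`:

  `∑_{n ≤ x, (n,h)=1, n w₁-rough, N w₂-rough} τ(n)^a τ(N)^b`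
  `≤ C (m/φ(m)) (h/φ(h)) · x/(log w₁ log w₂) · (log x/log w₁)^κ (log x/log w₂)^κ`,

`C = C(a,b,B)`, `κ = κ(a,b,B)` (`PairDivisorSums.sum_pow_card_divisors_le`).  This is Lemma 3.1(i) of
Matomäki–Merikoski (IMRN 2023, arXiv:2112.11412, p. 9 of the arXiv version: for `m = 1` and all `n ≤ X`,
"`∑_{n ≤ X} τ(n)^{m₁} 1_{(n,P(w₁))=1} τ(±n+h)^{m₂} 1_{(±n+h,P_h(w₂))=1} ≪_{m₁,m₂} (h/φ(h)) (X/log²X)(log X/log w₁)^{2^{m₁}+1}(log X/log w₂)^{2^{m₂}}`",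
quoted there from Henriot's Nair–Tenenbaum bound) in a COARSE form: the exponents `κ` are not the sharp
`2^{mᵢ}` (they come from Landreau's inequality), the range is the "long" one of Henriot's theorem
(`m, h ≤ x^B`, constants depending on `B`), and the statement is restricted to `(n, h) = 1` (the case
treated first in the source's proof of Lemma 2.1; then `N` has no prime factor dividing `hm`, so
"`(N, P_h(w₂)) = 1`" is plain `w₂`-roughness).  The coarse exponents suffice wherever the source only
needs polynomial dependence on `log X/log wᵢ` ((2.6), the first step of §5, the part `(n,h) > 1` of
Lemma 2.1), NOT for the main part of Lemma 2.1.

## Proof (elementary; no Nair–Tenenbaum machinery)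

* Landreau's inequality with a power (`card_divisors_pow_le_sum_of_le`, from the tree's
  `Landreau.exists_factorization`): `τ(n)^a ≤ C ∑_{d ∣ n, d ≤ X^ε} τ(d)^M` for `n ≤ X`.
* Hence the sum is `≤ C² ∑_{d, e ≤ x^{1/4}} τ(d)^M τ(e)^M #{n : d ∣ n, e ∣ N, …}` with `d` `w₁`-rough, `e`
  `w₂`-rough, `(d, e) = (d, h) = (e, hm) = 1`; writing `n = d(ej + r)` (`r` the root of `md·k + h ≡ 0 (mod e)`)
  the count is a sieve problem for the forms `(de·j + dr, mde·j + (mdr + h))` (determinant `deh`), of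
  length `x/(de) ≥ x^{1/2}`, settled by the tree's `PairLinearSieve.card_sifted_le`:
  `≪ (de/φ(de)) (m d²e²h/φ(m d²e²h)) (x/(de))/(log w₁ log w₂) + O(1)`.
* `k/φ(k) ≤ τ(k)` and super-multiplicativity of `φ` turn the arithmetic factors into
  `(m/φ(m))(h/φ(h)) τ(d)³ τ(e)³` (`count_pair_le`); the sums `∑_{d ≤ x^{1/4}, w-rough} τ(d)^{M+3}/d
  ≪ (log x/log w)^{2^{M+3}}` are the tree's `RoughSums.exists_sum_rough_sigma_zero_pow_div_le'`, and the
  `O(1)` remainders total `≪ x^{1/2} (log x)^{O(1)} ≪ x/log² x` (`exists_sum_sigma_zero_pow_le_real`);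
  the bookkeeping is `double_sum_le`, the case `x ≥ 4096` is `sum_pow_card_divisors_le_of_large` and
  small `x` are trivial.

## References

* K. Matomäki, J. Merikoski, IMRN 2023 (arXiv:2112.11412), Lemma 3.1(i). [cite: MatomakiMerikoski2023, Lemma 3.1]
* K. Henriot, Math. Proc. Cambridge Philos. Soc. 152 (2012), Thm 3 (arXiv:1102.1643). [Henriot2012]
* T. Tao, J. Teräväinen, J. London Math. Soc. 106 (2022), Lemma 3.1 (Landreau's inequality). [TaoTeravainen2021]
-/

noncomputable section

open Finset Real
open scoped ArithmeticFunction.Omega ArithmeticFunction.sigma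

namespace Literature.NumberTheory.Sieve

namespace PairDivisorSums

open Landreau (exists_factorization card_divisors_prod_le_pow cardFactors_div_smoothPart_le)

/-! ### Landreau's inequality with a power -/

/-- `τ(ab) ≤ τ(a)τ(b)`. [folklore] -/
private theorem card_divisors_mul_le (a b : ℕ) : (a * b).divisors.card ≤ a.divisors.card * b.divisors.card := by
  rw [Nat.divisors_mul]; exact Finset.card_mul_le

/-- `τ(m) ≤ 2^{Ω(m)}` for `m ≠ 0`. [folklore] -/
private theorem card_divisors_le_two_pow_cardFactors {m : ℕ} (hm : m ≠ 0) : m.divisors.card ≤ 2 ^ Ω m := by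
  rw [Nat.card_divisors hm, ArithmeticFunction.cardFactors_apply,
    ← List.sum_toFinset_count_eq_length, ← Finset.prod_pow_eq_pow_sum]
  have hset : m.primeFactorsList.toFinset = m.primeFactors := rfl
  rw [hset]
  refine Finset.prod_le_prod' fun p _ => ?_
  rw [Nat.primeFactorsList_count_eq]
  exact Nat.succ_le_of_lt Nat.lt_two_pow_self

/-- **Landreau's inequality with a power**: for `ε > 0` and `s ∈ ℕ` there are `C > 0` and `M` with
`τ(n)^s ≤ C ∑_{d ∣ n, d ≤ X^ε} τ(d)^M` whenever `1 ≤ n ≤ X` (the proof of Tao–Teräväinen's Lemma 3.1(ii),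
as in the tree's `Landreau.card_divisors_le_sum`, raised to the power `s`: `τ(n) ≤ 2^{2/ε} τ(b)^{m}` for the
Landreau factor `b` of `n_(≤z)` with the most divisors, so `τ(n)^s ≤ 2^{2s/ε} τ(b)^{ms}`).
[cite: TaoTeravainen2021, Lemma 3.1 (ii)] -/
theorem card_divisors_pow_le_sum_of_le {ε : ℝ} (hε : 0 < ε) (s : ℕ) :
    ∃ C : ℝ, 0 < C ∧ ∃ M : ℕ, ∀ (X : ℝ) (n : ℕ), n ≠ 0 → (n : ℝ) ≤ X →
      ((n.divisors.card : ℝ)) ^ s ≤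
        C * ∑ d ∈ n.divisors, if (d : ℝ) ≤ X ^ ε then ((d.divisors.card : ℕ) : ℝ) ^ M else 0 := by
  refine ⟨((2 : ℝ) ^ (2 / ε)) ^ s, by positivity, ⌊1 + 2 / ε⌋₊ * s, fun X n hn hnX => ?_⟩
  set C : ℝ := ((2 : ℝ) ^ (2 / ε)) ^ s with hC
  set M₀ : ℕ := ⌊1 + 2 / ε⌋₊ with hM₀
  set y : ℝ := X ^ ε with hy_def
  have hC1 : 1 ≤ C := one_le_pow₀ (Real.one_le_rpow one_le_two (by positivity))
  have hn0 : (0 : ℝ) < n := by exact_mod_cast Nat.pos_of_ne_zero hn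
  have hX0 : 0 < X := hn0.trans_le hnX
  have hy : (n : ℝ) ^ ε ≤ y := Real.rpow_le_rpow hn0.le hnX hε.le
  have hterm_nonneg : ∀ d ∈ n.divisors,
      (0 : ℝ) ≤ if (d : ℝ) ≤ y then ((d.divisors.card : ℕ) : ℝ) ^ (M₀ * s) else 0 := by
    intro d _; split_ifs <;> positivity
  have hy1 : (1 : ℝ) ≤ y := (Real.one_le_rpow (by exact_mod_cast Nat.pos_of_ne_zero hn) hε.le).trans hy
  have hsingle : ∀ a : ℕ, a ∣ n → (a : ℝ) ≤ y →
      ((a.divisors.card : ℕ) : ℝ) ^ (M₀ * s) ≤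
        ∑ d ∈ n.divisors, if (d : ℝ) ≤ y then ((d.divisors.card : ℕ) : ℝ) ^ (M₀ * s) else 0 := by
    intro a ha hay
    have hmem : a ∈ n.divisors := Nat.mem_divisors.mpr ⟨ha, hn⟩
    have := Finset.single_le_sum hterm_nonneg hmem
    simpa [hay] using this
  have hsum1 : (1 : ℝ) ≤ ∑ d ∈ n.divisors, if (d : ℝ) ≤ y then ((d.divisors.card : ℕ) : ℝ) ^ (M₀ * s) else 0 := by
    have := hsingle 1 (one_dvd n) (by exact_mod_cast hy1)
    simpa using this
  rcases Nat.lt_or_ge 1 n with h1n | hn1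
  · have hn1 : (1 : ℝ) < n := by exact_mod_cast h1n
    have hlogn : 0 < Real.log n := Real.log_pos hn1
    set z : ℝ := (n : ℝ) ^ (ε / 2) with hz
    set y₀ : ℝ := (n : ℝ) ^ ε with hy₀
    have hz1 : 1 < z := Real.one_lt_rpow hn1 (by positivity)
    have hz0 : 0 < z := by linarith
    have hzy : z < y₀ := Real.rpow_lt_rpow_of_exponent_lt hn1 (by linarith)
    have hlogz : Real.log z = ε / 2 * Real.log n := Real.log_rpow hn0 _
    have hyz : y₀ / z = z := by
      rw [hy₀, hz, ← Real.rpow_sub hn0]; congr 1; ring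
    obtain ⟨l, hlprod, hlmem, hllen⟩ := exists_factorization hz1 hzy hn
    set k := ⌊z⌋₊ + 1 with hk
    have hsplit : n.divisors.card = (smoothPart k n).divisors.card * (n / smoothPart k n).divisors.card := by
      conv_lhs => rw [← smoothPart_mul_div hn k]
      exact Nat.Coprime.card_divisors_mul (coprime_smoothPart_div hn)
    -- `τ(n_(>z)) ≤ 2^{2/ε}`
    have hrough : ((n / smoothPart k n).divisors.card : ℝ) ≤ (2 : ℝ) ^ (2 / ε) := by
      have h1 : ((n / smoothPart k n).divisors.card : ℝ) ≤ (2 : ℝ) ^ (Ω (n / smoothPart k n) : ℝ) := by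
        rw [Real.rpow_natCast]
        exact_mod_cast card_divisors_le_two_pow_cardFactors (m := n / smoothPart k n)
          fun h0 => hn (by rw [← smoothPart_mul_div hn k, h0, mul_zero])
      have h2 : (Ω (n / smoothPart k n) : ℝ) ≤ 2 / ε := by
        have := cardFactors_div_smoothPart_le hz1 hn
        rw [hlogz] at this
        calc (Ω (n / smoothPart (⌊z⌋₊ + 1) n) : ℝ) ≤ Real.log n / (ε / 2 * Real.log n) := this
          _ = 2 / ε := by field_simp
      exact h1.trans (Real.rpow_le_rpow_of_exponent_le one_le_two h2)
    -- `τ(n_(≤z))^s ≤ τ(b)^{M₀ s}` for the Landreau factor `b` with the most divisors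
    have hsmooth : ((smoothPart k n).divisors.card : ℝ) ^ s ≤
        ∑ d ∈ n.divisors, if (d : ℝ) ≤ y then ((d.divisors.card : ℕ) : ℝ) ^ (M₀ * s) else 0 := by
      have hmM : l.length ≤ M₀ := by
        rw [hM₀]
        refine Nat.le_floor ?_
        have : Real.log n / Real.log (y₀ / z) = 2 / ε := by rw [hyz, hlogz]; field_simp
        rw [this] at hllen
        exact_mod_cast hllen
      rcases l with _ | ⟨a, l'⟩
      · rw [List.prod_nil] at hlprod
        rw [← hlprod]
        simpa using hsum1
      · classical
        set L := a :: l' with hL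
        have hLne : L.toFinset.Nonempty := ⟨a, by simp [hL]⟩
        obtain ⟨b, hbL, hbmax⟩ := Finset.exists_max_image L.toFinset (fun c => c.divisors.card) hLne
        rw [List.mem_toFinset] at hbL
        obtain ⟨hb1, hby, hbn, -⟩ := hlmem b hbL
        have hB : ∀ c ∈ L, c.divisors.card ≤ b.divisors.card := fun c hc => hbmax c (List.mem_toFinset.mpr hc)
        have hτb : 0 < b.divisors.card := Finset.card_pos.mpr ⟨1, Nat.one_mem_divisors.mpr (by omega)⟩
        have h1 : (smoothPart k n).divisors.card ≤ b.divisors.card ^ M₀ := by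
          rw [← hlprod]
          exact (card_divisors_prod_le_pow L hB).trans (Nat.pow_le_pow_right hτb hmM)
        have hby' : (b : ℝ) ≤ y := hby.trans hy
        calc ((smoothPart k n).divisors.card : ℝ) ^ s ≤ (((b.divisors.card ^ M₀ : ℕ) : ℝ)) ^ s := by
              exact pow_le_pow_left₀ (Nat.cast_nonneg _) (by exact_mod_cast h1) s
          _ = ((b.divisors.card : ℕ) : ℝ) ^ (M₀ * s) := by push_cast; ring
          _ ≤ _ := hsingle b hbn hby'
    have hr0 : 0 ≤ ((n / smoothPart k n).divisors.card : ℝ) := Nat.cast_nonneg _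
    calc ((n.divisors.card : ℝ)) ^ s
        = ((smoothPart k n).divisors.card : ℝ) ^ s * ((n / smoothPart k n).divisors.card : ℝ) ^ s := by
          rw [hsplit, Nat.cast_mul, mul_pow]
      _ ≤ (∑ d ∈ n.divisors, if (d : ℝ) ≤ y then ((d.divisors.card : ℕ) : ℝ) ^ (M₀ * s) else 0) *
            ((2 : ℝ) ^ (2 / ε)) ^ s :=
          mul_le_mul hsmooth (pow_le_pow_left₀ hr0 hrough s) (by positivity) (Finset.sum_nonneg hterm_nonneg)
      _ = C * _ := by rw [hC, mul_comm]
  · have hn1' : n = 1 := by omega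
    subst hn1'
    simp only [Nat.divisors_one, Finset.card_singleton, Nat.cast_one, one_pow] at hsum1 ⊢
    calc (1 : ℝ) ≤ 1 * 1 := by norm_num
      _ ≤ C * _ := mul_le_mul hC1 hsum1 zero_le_one (by linarith)

/-! ### Arithmetic factors -/

/-- `k/φ(k) ≤ τ(k)` for `k ≠ 0` (the tree's `inv_totient_le_sigma_zero_div`: `1/φ(k) ≤ τ(k)/k`). [folklore] -/
private theorem self_div_totient_le_card_divisors {k : ℕ} (hk : k ≠ 0) :
    (k : ℝ) / Nat.totient k ≤ k.divisors.card := by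
  have hk0 : (0 : ℝ) < k := by exact_mod_cast Nat.pos_of_ne_zero hk
  have h := inv_totient_le_sigma_zero_div k
  rw [ArithmeticFunction.sigma_zero_apply] at h
  calc (k : ℝ) / Nat.totient k = k * ((Nat.totient k : ℝ))⁻¹ := by rw [div_eq_mul_inv]
    _ ≤ k * ((k.divisors.card : ℝ) / k) := mul_le_mul_of_nonneg_left h hk0.le
    _ = k.divisors.card := by field_simp

/-- Super-multiplicativity: `(kl)/φ(kl) ≤ (k/φ(k)) (l/φ(l))` (`k, l ≠ 0`). [folklore] -/
private theorem mul_div_totient_le {k l : ℕ} (hk : k ≠ 0) (hl : l ≠ 0) :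
    ((k * l : ℕ) : ℝ) / Nat.totient (k * l) ≤ ((k : ℝ) / Nat.totient k) * ((l : ℝ) / Nat.totient l) := by
  have hφk : (0 : ℝ) < Nat.totient k := by exact_mod_cast Nat.totient_pos.mpr (Nat.pos_of_ne_zero hk)
  have hφl : (0 : ℝ) < Nat.totient l := by exact_mod_cast Nat.totient_pos.mpr (Nat.pos_of_ne_zero hl)
  have hφkl : (0 : ℝ) < Nat.totient (k * l) := by
    exact_mod_cast Nat.totient_pos.mpr (Nat.pos_of_ne_zero (Nat.mul_ne_zero hk hl))
  have hsup : (Nat.totient k : ℝ) * Nat.totient l ≤ Nat.totient (k * l) := by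
    exact_mod_cast Nat.totient_super_multiplicative k l
  rw [div_mul_div_comm, div_le_div_iff₀ hφkl (mul_pos hφk hφl)]
  push_cast
  have : (0 : ℝ) ≤ (k : ℝ) * l := by positivity
  nlinarith

/-- `1 ≤ k/φ(k)` for `k ≠ 0`. [folklore] -/
private theorem one_le_self_div_totient {k : ℕ} (hk : k ≠ 0) : 1 ≤ (k : ℝ) / Nat.totient k := by
  have hφ : (0 : ℝ) < Nat.totient k := by exact_mod_cast Nat.totient_pos.mpr (Nat.pos_of_ne_zero hk)
  rw [le_div_iff₀ hφ, one_mul]; exact_mod_cast Nat.totient_le k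

/-! ### The count of `n ≤ x` with `d ∣ n`, `e ∣ mn + h` over rough pairs: substitution into the pair sieve -/

/-- The determinant of the substituted forms: `|de·(mdr + h) − mde·dr| = deh`. [folklore] -/
theorem det_subst (d e m r h : ℕ) :
    PairLinearSieve.det (d * e) (d * r) (m * d * e) (m * d * r + h) = d * e * h := by
  unfold PairLinearSieve.det
  have : ((d * e : ℕ) : ℤ) * ((m * d * r + h : ℕ) : ℤ) - ((m * d * e : ℕ) : ℤ) * ((d * r : ℕ) : ℤ) =
      ((d * e * h : ℕ) : ℤ) := by push_cast; ring
  rw [this, Int.natAbs_natCast]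

/-- **The sieve count after the substitution `n = d(ej + r)`.**  Let `C₀` be the constant of
`PairLinearSieve.card_sifted_le`.  For `d, e, m, h ≥ 1` with `(md, e) = 1`, `x ∈ ℕ`, `K = x/(de) ≥ 2` and
`2 ≤ w₁', w₂' ≤ K`, the number of `n ≤ x` with `d ∣ n`, `e ∣ mn + h`, every prime factor of `n` at least
`w₁'` and every prime factor of `mn + h` at least `w₂'` is
`≤ C₀ (de/φ(de)) (A/φ(A)) K/(log w₁' log w₂') + 1`, `A = mde · deh`. [folklore] -/
theorem count_subst_le {C₀ : ℝ}
    (HS : ∀ (K α₁ β₁ α₂ β₂ : ℕ), 1 ≤ α₁ → 1 ≤ α₂ → PairLinearSieve.det α₁ β₁ α₂ β₂ ≠ 0 →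
      ∀ w₁ w₂ : ℝ, 2 ≤ w₁ → w₁ ≤ K → 2 ≤ w₂ → w₂ ≤ K →
      (#{k ∈ Icc 1 K | (∀ p ∈ (α₁ * k + β₁).primeFactors, w₁ ≤ (p : ℝ)) ∧
          (∀ p ∈ (α₂ * k + β₂).primeFactors, w₂ ≤ (p : ℝ) ∨ p ∣ α₂ * PairLinearSieve.det α₁ β₁ α₂ β₂)} : ℝ) ≤
        C₀ * ((α₁ : ℝ) / Nat.totient α₁) *
          (((α₂ * PairLinearSieve.det α₁ β₁ α₂ β₂ : ℕ) : ℝ) /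
            Nat.totient (α₂ * PairLinearSieve.det α₁ β₁ α₂ β₂)) * (K : ℝ) / (Real.log w₁ * Real.log w₂))
    {x d e m h : ℕ} (hd : 1 ≤ d) (he : 1 ≤ e) (hm : 1 ≤ m) (hh : 1 ≤ h) (hcop : Nat.Coprime (m * d) e)
    {w₁' w₂' : ℝ} (hw₁ : 2 ≤ w₁') (hw₁K : w₁' ≤ ((x / (d * e) : ℕ) : ℝ)) (hw₂ : 2 ≤ w₂')
    (hw₂K : w₂' ≤ ((x / (d * e) : ℕ) : ℝ)) :
    (#{n ∈ Icc 1 x | d ∣ n ∧ e ∣ m * n + h ∧ (∀ p ∈ n.primeFactors, w₁' ≤ (p : ℝ)) ∧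
        (∀ p ∈ (m * n + h).primeFactors, w₂' ≤ (p : ℝ))} : ℝ) ≤
      C₀ * (((d * e : ℕ) : ℝ) / Nat.totient (d * e)) *
        (((m * d * e * (d * e * h) : ℕ) : ℝ) / Nat.totient (m * d * e * (d * e * h))) *
        ((x / (d * e) : ℕ) : ℝ) / (Real.log w₁' * Real.log w₂') + 1 := by
  classical
  set K : ℕ := x / (d * e) with hK
  set r : ℕ := PairLinearSieve.root (m * d) h e with hr
  have he0 : 0 < e := by omega
  have hd0 : 0 < d := by omega
  have hde0 : 0 < d * e := Nat.mul_pos hd0 he0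
  have hr_lt : r < e := PairLinearSieve.root_lt he0
  -- the Layer-1 set
  set T := {k ∈ Icc 1 K | (∀ p ∈ (d * e * k + d * r).primeFactors, w₁' ≤ (p : ℝ)) ∧
      (∀ p ∈ (m * d * e * k + (m * d * r + h)).primeFactors, w₂' ≤ (p : ℝ) ∨
        p ∣ m * d * e * PairLinearSieve.det (d * e) (d * r) (m * d * e) (m * d * r + h))} with hT
  have hdet := det_subst d e m r h
  have hS := HS K (d * e) (d * r) (m * d * e) (m * d * r + h) hde0 (Nat.mul_pos (Nat.mul_pos (by omega) hd0) he0)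
    (by rw [hdet]; exact Nat.mul_ne_zero (Nat.mul_ne_zero (by omega) (by omega)) (by omega))
    w₁' w₂' hw₁ hw₁K hw₂ hw₂K
  rw [← hT, hdet] at hS
  -- the map `n ↦ (n/d)/e` sends the counted `n` with `n/d ≥ e` into `T`, and at most one `n` has `n/d < e`
  set S := {n ∈ Icc 1 x | d ∣ n ∧ e ∣ m * n + h ∧ (∀ p ∈ n.primeFactors, w₁' ≤ (p : ℝ)) ∧
      (∀ p ∈ (m * n + h).primeFactors, w₂' ≤ (p : ℝ))} with hSdef
  have hstruct : ∀ n ∈ S, n = d * (e * (n / d / e) + r) := by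
    intro n hn
    rw [hSdef, Finset.mem_filter, Finset.mem_Icc] at hn
    obtain ⟨⟨hn1, -⟩, ⟨c, hc⟩, hediv, -, -⟩ := hn
    have hcd : n / d = c := by rw [hc, Nat.mul_div_cancel_left _ hd0]
    rw [hcd]
    -- `e ∣ m d c + h`, so `c % e = r`
    have hmod : c % e = r := by
      rw [hr]
      refine (PairLinearSieve.dvd_linear_iff_mod_eq_root he0 hcop c).mp ?_
      rw [hc, ← mul_assoc] at hediv
      exact hediv
    have := Nat.div_add_mod c e
    rw [hmod] at this
    rw [hc, this]
  have hsplit : S ⊆ (S.filter (fun n => 1 ≤ n / d / e)) ∪ {d * r} := by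
    intro n hn
    rw [Finset.mem_union, Finset.mem_filter, Finset.mem_singleton]
    by_cases h1 : 1 ≤ n / d / e
    · exact Or.inl ⟨hn, h1⟩
    · right
      have h0 : n / d / e = 0 := Nat.lt_one_iff.mp (not_le.mp h1)
      have := hstruct n hn
      rw [h0, mul_zero, zero_add] at this
      exact this
  have hinj : (#(S.filter (fun n => 1 ≤ n / d / e)) : ℝ) ≤ #T := by
    refine Nat.cast_le.mpr (Finset.card_le_card_of_injOn (fun n => n / d / e) ?_ ?_)
    · intro n hn
      have hn' := Finset.mem_filter.mp (Finset.mem_coe.mp hn)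
      have hnS := hn'.1
      have hj1 := hn'.2
      have hrepr := hstruct n hnS
      rw [hSdef, Finset.mem_filter, Finset.mem_Icc] at hnS
      obtain ⟨⟨hn1, hnx⟩, -, -, hc1, hc2⟩ := hnS
      set j := n / d / e with hj
      rw [Finset.mem_coe, hT, Finset.mem_filter, Finset.mem_Icc]
      have hn_eq : d * e * j + d * r = n := by rw [hrepr]; ring_nf
      have hN_eq : m * d * e * j + (m * d * r + h) = m * n + h := by rw [hrepr]; ring
      refine ⟨⟨hj1, ?_⟩, ?_, ?_⟩
      · -- `j ≤ x/(de)` since `de·j ≤ n ≤ x`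
        rw [hK, Nat.le_div_iff_mul_le hde0]
        calc j * (d * e) = d * e * j := by ring
          _ ≤ d * e * j + d * r := Nat.le_add_right _ _
          _ = n := hn_eq
          _ ≤ x := hnx
      · rw [hn_eq]; exact hc1
      · rw [hN_eq]; exact fun p hp => Or.inl (hc2 p hp)
    · intro n₁ hn₁ n₂ hn₂ heq
      have h1 := hstruct n₁ (Finset.mem_filter.mp (Finset.mem_coe.mp hn₁)).1
      have h2 := hstruct n₂ (Finset.mem_filter.mp (Finset.mem_coe.mp hn₂)).1
      dsimp only at heq
      rw [h1, h2, heq]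
  calc (#S : ℝ) ≤ #((S.filter (fun n => 1 ≤ n / d / e)) ∪ {d * r}) := by exact_mod_cast Finset.card_le_card hsplit
    _ ≤ #(S.filter (fun n => 1 ≤ n / d / e)) + #({d * r} : Finset ℕ) := by exact_mod_cast Finset.card_union_le _ _
    _ ≤ #T + 1 := by rw [Finset.card_singleton, Nat.cast_one]; exact add_le_add hinj le_rfl
    _ ≤ _ := add_le_add hS le_rfl

/-! ### Bookkeeping: Landreau in indicator form, and the swap of summations -/

/-- Landreau's inequality with the short divisors indexed by an initial segment:
`τ(n)^s ≤ C ∑_{1 ≤ d ≤ X^ε} 1_{d ∣ n} τ(d)^M` for `1 ≤ n ≤ X`. [cite: TaoTeravainen2021, Lemma 3.1 (ii)] -/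
theorem card_divisors_pow_le_sum_Icc {ε : ℝ} (hε : 0 < ε) (s : ℕ) :
    ∃ C : ℝ, 0 < C ∧ ∃ M : ℕ, ∀ (X : ℝ) (n : ℕ), n ≠ 0 → (n : ℝ) ≤ X →
      ((n.divisors.card : ℝ)) ^ s ≤
        C * ∑ d ∈ Icc 1 ⌊X ^ ε⌋₊, if d ∣ n then ((d.divisors.card : ℕ) : ℝ) ^ M else 0 := by
  obtain ⟨C, hC, M, H⟩ := card_divisors_pow_le_sum_of_le hε s
  refine ⟨C, hC, M, fun X n hn hnX => (H X n hn hnX).trans (le_of_eq ?_)⟩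
  congr 1
  classical
  rw [← Finset.sum_filter, ← Finset.sum_filter]
  refine Finset.sum_congr ?_ fun _ _ => rfl
  ext d
  rw [Finset.mem_filter, Finset.mem_filter, Nat.mem_divisors, Finset.mem_Icc]
  have hX0 : 0 ≤ X ^ ε := Real.rpow_nonneg ((Nat.cast_nonneg n).trans hnX) ε
  constructor
  · rintro ⟨⟨hdn, -⟩, hdX⟩
    exact ⟨⟨Nat.pos_of_dvd_of_pos hdn (Nat.pos_of_ne_zero hn), Nat.le_floor hdX⟩, hdn⟩
  · rintro ⟨⟨hd1, hdX⟩, hdn⟩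
    exact ⟨⟨hdn, hn⟩, (Nat.le_floor_iff hX0).mp hdX⟩

/-- The swap of summations: for finite sets `A, D, E`, weights `u, v` and a map `f`,
`∑_{n ∈ A} (∑_{d ∈ D} 1_{d∣n} u(d)) (∑_{e ∈ E} 1_{e∣f(n)} v(e)) = ∑_{d ∈ D} ∑_{e ∈ E} u(d) v(e) #{n ∈ A : d ∣ n, e ∣ f(n)}`.
[folklore] -/
theorem sum_mul_sum_indicator_eq (A D E : Finset ℕ) (u v : ℕ → ℝ) (f : ℕ → ℕ) :
    ∑ n ∈ A, (∑ d ∈ D, if d ∣ n then u d else 0) * (∑ e ∈ E, if e ∣ f n then v e else 0) =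
      ∑ d ∈ D, ∑ e ∈ E, u d * v e * #{n ∈ A | d ∣ n ∧ e ∣ f n} := by
  classical
  have h1 : ∀ n ∈ A, (∑ d ∈ D, if d ∣ n then u d else 0) * (∑ e ∈ E, if e ∣ f n then v e else 0) =
      ∑ d ∈ D, ∑ e ∈ E, if d ∣ n ∧ e ∣ f n then u d * v e else 0 := by
    intro n _
    rw [Finset.sum_mul_sum]
    refine Finset.sum_congr rfl fun d _ => Finset.sum_congr rfl fun e _ => ?_
    by_cases hd : d ∣ n <;> by_cases he : e ∣ f n <;> simp [hd, he]
  rw [Finset.sum_congr rfl h1, Finset.sum_comm]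
  refine Finset.sum_congr rfl fun d _ => ?_
  rw [Finset.sum_comm]
  refine Finset.sum_congr rfl fun e _ => ?_
  rw [Finset.card_eq_sum_ones, Nat.cast_sum, Finset.mul_sum, Finset.sum_filter]
  refine Finset.sum_congr rfl fun n _ => ?_
  split_ifs <;> simp

/-! ### The count for one pair `(d, e)` with the arithmetic factors made explicit -/

set_option maxHeartbeats 800000 in
/-- For one pair `(d, e)`: the admissible `n ≤ x` (`(n,h) = 1`, `n` `w₁`-rough, `mn+h` `w₂`-rough) with
`d ∣ n`, `e ∣ mn + h` number at most
`1_{d w₁-rough, e w₂-rough} · (9 C₀ (m/φ(m))(h/φ(h)) τ(d)³ τ(e)³ x/(de log w₁ log w₂) + 1)`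
whenever `x^{1/3} ≤ x/(de)` and `x ≥ 8` (`C₀` the pair-sieve constant). [folklore] -/
theorem count_pair_le {C₀ : ℝ} (hC₀ : 0 < C₀)
    (HS : ∀ (K α₁ β₁ α₂ β₂ : ℕ), 1 ≤ α₁ → 1 ≤ α₂ → PairLinearSieve.det α₁ β₁ α₂ β₂ ≠ 0 →
      ∀ w₁ w₂ : ℝ, 2 ≤ w₁ → w₁ ≤ K → 2 ≤ w₂ → w₂ ≤ K →
      (#{k ∈ Icc 1 K | (∀ p ∈ (α₁ * k + β₁).primeFactors, w₁ ≤ (p : ℝ)) ∧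
          (∀ p ∈ (α₂ * k + β₂).primeFactors, w₂ ≤ (p : ℝ) ∨ p ∣ α₂ * PairLinearSieve.det α₁ β₁ α₂ β₂)} : ℝ) ≤
        C₀ * ((α₁ : ℝ) / Nat.totient α₁) *
          (((α₂ * PairLinearSieve.det α₁ β₁ α₂ β₂ : ℕ) : ℝ) /
            Nat.totient (α₂ * PairLinearSieve.det α₁ β₁ α₂ β₂)) * (K : ℝ) / (Real.log w₁ * Real.log w₂))
    {x m h d e : ℕ} (hx : 8 ≤ x) (hm : 1 ≤ m) (hh : 1 ≤ h) (hmh : Nat.Coprime m h) (hd : 1 ≤ d) (he : 1 ≤ e)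
    (hK : (x : ℝ) ^ ((1 : ℝ) / 3) ≤ ((x / (d * e) : ℕ) : ℝ)) {w₁ w₂ : ℝ} (hw₁ : 2 ≤ w₁) (hw₁x : w₁ ≤ x)
    (hw₂ : 2 ≤ w₂) (hw₂x : w₂ ≤ x) :
    (#{n ∈ Icc 1 x | (Nat.Coprime n h ∧ (∀ p ∈ n.primeFactors, w₁ ≤ (p : ℝ)) ∧
        (∀ p ∈ (m * n + h).primeFactors, w₂ ≤ (p : ℝ))) ∧ (d ∣ n ∧ e ∣ m * n + h)} : ℝ) ≤
      (if (∀ p ∈ d.primeFactors, w₁ ≤ (p : ℝ)) ∧ (∀ p ∈ e.primeFactors, w₂ ≤ (p : ℝ)) then 1 else 0) *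
        (9 * C₀ * (((m : ℝ) / Nat.totient m) * ((h : ℝ) / Nat.totient h)) *
          (((d.divisors.card : ℝ)) ^ 3 * ((e.divisors.card : ℝ)) ^ 3) * ((x : ℝ) / (d * e)) /
            (Real.log w₁ * Real.log w₂) + 1) := by
  classical
  set S := {n ∈ Icc 1 x | (Nat.Coprime n h ∧ (∀ p ∈ n.primeFactors, w₁ ≤ (p : ℝ)) ∧
      (∀ p ∈ (m * n + h).primeFactors, w₂ ≤ (p : ℝ))) ∧ (d ∣ n ∧ e ∣ m * n + h)} with hSdef
  set K : ℕ := x / (d * e) with hKdef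
  set F : ℝ := ((m : ℝ) / Nat.totient m) * ((h : ℝ) / Nat.totient h) with hF
  have hm0 : m ≠ 0 := by omega
  have hh0 : h ≠ 0 := by omega
  have hd0 : d ≠ 0 := by omega
  have he0 : e ≠ 0 := by omega
  have hx0 : (0 : ℝ) < x := by exact_mod_cast (show 0 < x by omega)
  have hx1 : (1 : ℝ) ≤ x := by exact_mod_cast (show 1 ≤ x by omega)
  have hF1 : 1 ≤ F := one_le_mul_of_one_le_of_one_le (one_le_self_div_totient hm0) (one_le_self_div_totient hh0)
  have hlogw₁ : 0 < Real.log w₁ := Real.log_pos (by linarith)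
  have hlogw₂ : 0 < Real.log w₂ := Real.log_pos (by linarith)
  have hτd : (1 : ℝ) ≤ d.divisors.card := by
    exact_mod_cast Finset.card_pos.mpr ⟨1, Nat.one_mem_divisors.mpr hd0⟩
  have hτe : (1 : ℝ) ≤ e.divisors.card := by
    exact_mod_cast Finset.card_pos.mpr ⟨1, Nat.one_mem_divisors.mpr he0⟩
  have hRHS0 : 0 ≤ 9 * C₀ * F * (((d.divisors.card : ℝ)) ^ 3 * ((e.divisors.card : ℝ)) ^ 3) *
      ((x : ℝ) / (d * e)) / (Real.log w₁ * Real.log w₂) + 1 := by positivity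
  by_cases hS0 : S = ∅
  · rw [hS0, Finset.card_empty, Nat.cast_zero]
    split_ifs
    · rw [one_mul]; exact hRHS0
    · rw [zero_mul]
  obtain ⟨n₀, hn₀⟩ := Finset.nonempty_iff_ne_empty.mpr hS0
  have hn₀' := hn₀
  rw [hSdef, Finset.mem_filter, Finset.mem_Icc] at hn₀'
  obtain ⟨⟨hn₀1, hn₀x⟩, ⟨hcop₀, hr₁, hr₂⟩, hdn₀, hen₀⟩ := hn₀'
  have hn₀0 : n₀ ≠ 0 := by omega
  have hN₀0 : m * n₀ + h ≠ 0 := by positivity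
  -- `d` is `w₁`-rough, `e` is `w₂`-rough
  have hdr : ∀ p ∈ d.primeFactors, w₁ ≤ (p : ℝ) := fun p hp =>
    hr₁ p (Nat.mem_primeFactors.mpr ⟨Nat.prime_of_mem_primeFactors hp,
      (Nat.dvd_of_mem_primeFactors hp).trans hdn₀, hn₀0⟩)
  have her : ∀ p ∈ e.primeFactors, w₂ ≤ (p : ℝ) := fun p hp =>
    hr₂ p (Nat.mem_primeFactors.mpr ⟨Nat.prime_of_mem_primeFactors hp,
      (Nat.dvd_of_mem_primeFactors hp).trans hen₀, hN₀0⟩)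
  rw [if_pos ⟨hdr, her⟩, one_mul]
  -- `(md, e) = 1`
  have hgmh : Nat.gcd m h = 1 := hmh
  have hgnh : Nat.gcd n₀ h = 1 := hcop₀
  have hcop : Nat.Coprime (m * d) e := by
    refine Nat.Coprime.mul_left (Nat.coprime_of_dvd fun p hp hpm hpe => ?_) (Nat.coprime_of_dvd fun p hp hpd hpe => ?_)
    · have hpN : p ∣ m * n₀ + h := hpe.trans hen₀
      have hph : p ∣ h := (Nat.dvd_add_right (hpm.mul_right n₀)).mp hpN
      have h1 : p ∣ Nat.gcd m h := Nat.dvd_gcd hpm hph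
      rw [hgmh] at h1
      exact hp.ne_one (Nat.dvd_one.mp h1)
    · have hpN : p ∣ m * n₀ + h := hpe.trans hen₀
      have hpn : p ∣ n₀ := hpd.trans hdn₀
      have hph : p ∣ h := (Nat.dvd_add_right (hpn.mul_left m)).mp hpN
      have h1 : p ∣ Nat.gcd n₀ h := Nat.dvd_gcd hpn hph
      rw [hgnh] at h1
      exact hp.ne_one (Nat.dvd_one.mp h1)
  -- the capped sieving ranges
  have hx13 : (2 : ℝ) ≤ (x : ℝ) ^ ((1 : ℝ) / 3) := by
    have h8 : ((2 : ℝ) ^ (3 : ℕ)) ≤ x := by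
      norm_num; exact_mod_cast hx
    calc (2 : ℝ) = ((2 : ℝ) ^ (3 : ℕ)) ^ ((1 : ℝ) / 3) := by
          rw [← Real.rpow_natCast, ← Real.rpow_mul (by norm_num)]; norm_num
      _ ≤ (x : ℝ) ^ ((1 : ℝ) / 3) := Real.rpow_le_rpow (by norm_num) h8 (by norm_num)
  have hK2 : (2 : ℝ) ≤ K := hx13.trans hK
  have hlogK : Real.log x / 3 ≤ Real.log K := by
    have := Real.log_le_log (by positivity) hK
    rwa [Real.log_rpow hx0, one_div_mul_eq_div] at this
  set w₁' : ℝ := min w₁ K with hw₁'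
  set w₂' : ℝ := min w₂ K with hw₂'
  have hw₁'2 : 2 ≤ w₁' := le_min hw₁ hK2
  have hw₂'2 : 2 ≤ w₂' := le_min hw₂ hK2
  have hw₁'K : w₁' ≤ K := min_le_right _ _
  have hw₂'K : w₂' ≤ K := min_le_right _ _
  have hlogw' : ∀ {w : ℝ}, 2 ≤ w → w ≤ x → Real.log w / 3 ≤ Real.log (min w K) := by
    intro w hw hwx
    have hlw : 0 ≤ Real.log w := Real.log_nonneg (by linarith)
    rcases le_total w K with hle | hle
    · rw [min_eq_left hle]; linarith
    · rw [min_eq_right hle]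
      have : Real.log w ≤ Real.log x := Real.log_le_log (by linarith) hwx
      linarith
  have hl₁ := hlogw' hw₁ hw₁x
  have hl₂ := hlogw' hw₂ hw₂x
  rw [← hw₁'] at hl₁
  rw [← hw₂'] at hl₂
  have hl₁0 : 0 < Real.log w₁' := lt_of_lt_of_le (by positivity) hl₁
  have hl₂0 : 0 < Real.log w₂' := lt_of_lt_of_le (by positivity) hl₂
  -- `S ⊆` the set of `count_subst_le`
  set S' := {n ∈ Icc 1 x | d ∣ n ∧ e ∣ m * n + h ∧ (∀ p ∈ n.primeFactors, w₁' ≤ (p : ℝ)) ∧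
      (∀ p ∈ (m * n + h).primeFactors, w₂' ≤ (p : ℝ))} with hS'def
  have hsub : S ⊆ S' := by
    intro n hn
    rw [hSdef, Finset.mem_filter] at hn
    rw [hS'def, Finset.mem_filter]
    obtain ⟨hnI, ⟨-, h1, h2⟩, hdn, hen⟩ := hn
    exact ⟨hnI, hdn, hen, fun p hp => (min_le_left _ _).trans (h1 p hp),
      fun p hp => (min_le_left _ _).trans (h2 p hp)⟩
  have hcount := count_subst_le HS hd he hm hh hcop hw₁'2 hw₁'K hw₂'2 hw₂'K
  rw [← hS'def, ← hKdef] at hcount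
  -- the arithmetic factors
  have hτdφ : (d : ℝ) / Nat.totient d ≤ d.divisors.card := self_div_totient_le_card_divisors hd0
  have hτeφ : (e : ℝ) / Nat.totient e ≤ e.divisors.card := self_div_totient_le_card_divisors he0
  have hdφ1 : 1 ≤ (d : ℝ) / Nat.totient d := one_le_self_div_totient hd0
  have heφ1 : 1 ≤ (e : ℝ) / Nat.totient e := one_le_self_div_totient he0
  have hmφ1 : 1 ≤ (m : ℝ) / Nat.totient m := one_le_self_div_totient hm0
  have hhφ1 : 1 ≤ (h : ℝ) / Nat.totient h := one_le_self_div_totient hh0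
  have h1 : ((d * e : ℕ) : ℝ) / Nat.totient (d * e) ≤ d.divisors.card * e.divisors.card :=
    (mul_div_totient_le hd0 he0).trans (mul_le_mul hτdφ hτeφ (by positivity) (by positivity))
  have h2 : ((m * d * e * (d * e * h) : ℕ) : ℝ) / Nat.totient (m * d * e * (d * e * h)) ≤
      F * ((d.divisors.card : ℝ) ^ 2 * (e.divisors.card : ℝ) ^ 2) := by
    have hmde0 : m * d * e ≠ 0 := by positivity
    have hdeh0 : d * e * h ≠ 0 := by positivity
    have hA := mul_div_totient_le hmde0 hdeh0
    have hB : ((m * d * e : ℕ) : ℝ) / Nat.totient (m * d * e) ≤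
        (m : ℝ) / Nat.totient m * (d.divisors.card * e.divisors.card) := by
      calc ((m * d * e : ℕ) : ℝ) / Nat.totient (m * d * e)
          ≤ ((m * d : ℕ) : ℝ) / Nat.totient (m * d) * ((e : ℝ) / Nat.totient e) :=
            mul_div_totient_le (by positivity) he0
        _ ≤ ((m : ℝ) / Nat.totient m * ((d : ℝ) / Nat.totient d)) * ((e : ℝ) / Nat.totient e) :=
            mul_le_mul_of_nonneg_right (mul_div_totient_le hm0 hd0) (by positivity)
        _ ≤ (m : ℝ) / Nat.totient m * (d.divisors.card * e.divisors.card) := by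
            rw [mul_assoc]
            exact mul_le_mul_of_nonneg_left (mul_le_mul hτdφ hτeφ (by positivity) (by positivity)) (by positivity)
    have hC : ((d * e * h : ℕ) : ℝ) / Nat.totient (d * e * h) ≤
        (d.divisors.card * e.divisors.card) * ((h : ℝ) / Nat.totient h) := by
      calc ((d * e * h : ℕ) : ℝ) / Nat.totient (d * e * h)
          ≤ ((d * e : ℕ) : ℝ) / Nat.totient (d * e) * ((h : ℝ) / Nat.totient h) :=
            mul_div_totient_le (by positivity) hh0
        _ ≤ (d.divisors.card * e.divisors.card) * ((h : ℝ) / Nat.totient h) :=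
            mul_le_mul_of_nonneg_right h1 (by positivity)
    calc ((m * d * e * (d * e * h) : ℕ) : ℝ) / Nat.totient (m * d * e * (d * e * h))
        ≤ _ := hA
      _ ≤ ((m : ℝ) / Nat.totient m * (d.divisors.card * e.divisors.card)) *
          ((d.divisors.card * e.divisors.card) * ((h : ℝ) / Nat.totient h)) :=
          mul_le_mul hB hC (by positivity) (by positivity)
      _ = F * ((d.divisors.card : ℝ) ^ 2 * (e.divisors.card : ℝ) ^ 2) := by rw [hF]; ring
  have h3 : (K : ℝ) ≤ (x : ℝ) / (d * e) := by
    have : ((x / (d * e) : ℕ) : ℝ) ≤ (x : ℝ) / ((d * e : ℕ) : ℝ) := Nat.cast_div_le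
    push_cast at this
    exact this
  have h4 : 1 / (Real.log w₁' * Real.log w₂') ≤ 9 / (Real.log w₁ * Real.log w₂) := by
    rw [div_le_div_iff₀ (mul_pos hl₁0 hl₂0) (mul_pos hlogw₁ hlogw₂), one_mul]
    have := mul_le_mul hl₁ hl₂ (by positivity) hl₁0.le
    nlinarith [this]
  have hbound : C₀ * (((d * e : ℕ) : ℝ) / Nat.totient (d * e)) *
      (((m * d * e * (d * e * h) : ℕ) : ℝ) / Nat.totient (m * d * e * (d * e * h))) * (K : ℝ) /
        (Real.log w₁' * Real.log w₂') ≤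
      9 * C₀ * F * (((d.divisors.card : ℝ)) ^ 3 * ((e.divisors.card : ℝ)) ^ 3) * ((x : ℝ) / (d * e)) /
        (Real.log w₁ * Real.log w₂) := by
    have e1 : C₀ * (((d * e : ℕ) : ℝ) / Nat.totient (d * e)) *
        (((m * d * e * (d * e * h) : ℕ) : ℝ) / Nat.totient (m * d * e * (d * e * h))) * (K : ℝ) /
        (Real.log w₁' * Real.log w₂') =
        C₀ * ((((d * e : ℕ) : ℝ) / Nat.totient (d * e)) *
          ((((m * d * e * (d * e * h) : ℕ) : ℝ) / Nat.totient (m * d * e * (d * e * h))) *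
            ((K : ℝ) * (1 / (Real.log w₁' * Real.log w₂'))))) := by ring
    have e2 : 9 * C₀ * F * (((d.divisors.card : ℝ)) ^ 3 * ((e.divisors.card : ℝ)) ^ 3) * ((x : ℝ) / (d * e)) /
        (Real.log w₁ * Real.log w₂) =
        C₀ * ((d.divisors.card * e.divisors.card) *
          ((F * ((d.divisors.card : ℝ) ^ 2 * (e.divisors.card : ℝ) ^ 2)) *
            (((x : ℝ) / (d * e)) * (9 / (Real.log w₁ * Real.log w₂))))) := by ring
    rw [e1, e2]
    have hK0 : (0 : ℝ) ≤ K := Nat.cast_nonneg _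
    have hL'0 : 0 ≤ 1 / (Real.log w₁' * Real.log w₂') := by positivity
    have hA0 : 0 ≤ ((m * d * e * (d * e * h) : ℕ) : ℝ) / Nat.totient (m * d * e * (d * e * h)) :=
      div_nonneg (Nat.cast_nonneg _) (Nat.cast_nonneg _)
    have hτ0 : (0 : ℝ) ≤ d.divisors.card * e.divisors.card := by positivity
    have hF0 : 0 ≤ F * ((d.divisors.card : ℝ) ^ 2 * (e.divisors.card : ℝ) ^ 2) := by positivity
    have hx0' : 0 ≤ (x : ℝ) / (d * e) := by positivity
    refine mul_le_mul_of_nonneg_left ?_ hC₀.le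
    refine mul_le_mul h1 ?_ (mul_nonneg hA0 (mul_nonneg hK0 hL'0)) hτ0
    refine mul_le_mul h2 ?_ (mul_nonneg hK0 hL'0) hF0
    exact mul_le_mul h3 h4 hL'0 hx0'
  calc (#S : ℝ) ≤ #S' := by exact_mod_cast Finset.card_le_card hsub
    _ ≤ _ := hcount
    _ ≤ _ := add_le_add hbound le_rfl

/-! ### Auxiliary real-analysis facts -/

/-- `(log x)^{c} ≤ (2c)^c x^{1/2}` for `x ≥ 0`... in the form used: `(log x)^(c+2) ≤ K √x`. [folklore] -/
private theorem log_pow_le_mul_sqrt (c : ℕ) : ∃ K : ℝ, 0 < K ∧ ∀ x : ℝ, 1 ≤ x → Real.log x ^ c ≤ K * Real.sqrt x := by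
  rcases Nat.eq_zero_or_pos c with rfl | hc
  · refine ⟨1, one_pos, fun x hx => ?_⟩
    rw [pow_zero, one_mul]
    exact Real.one_le_sqrt.mpr hx
  refine ⟨(2 * (c : ℝ)) ^ c, by positivity, fun x hx => ?_⟩
  have hs : (0 : ℝ) < 1 / (2 * c) := by positivity
  have h1 : Real.log x ≤ x ^ (1 / (2 * (c : ℝ))) / (1 / (2 * c)) := Real.log_le_rpow_div (by linarith) hs
  have h2 : Real.log x ≤ (2 * c) * x ^ (1 / (2 * (c : ℝ))) := by
    rw [div_div_eq_mul_div, div_one] at h1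
    linarith
  have h0 : 0 ≤ Real.log x := Real.log_nonneg hx
  calc Real.log x ^ c ≤ ((2 * c) * x ^ (1 / (2 * (c : ℝ)))) ^ c := pow_le_pow_left₀ h0 h2 c
    _ = (2 * (c : ℝ)) ^ c * (x ^ (1 / (2 * (c : ℝ)))) ^ (c : ℕ) := by ring
    _ = (2 * (c : ℝ)) ^ c * Real.sqrt x := by
        rw [← Real.rpow_natCast (x ^ (1 / (2 * (c : ℝ)))) c, ← Real.rpow_mul (by linarith), Real.sqrt_eq_rpow]
        congr 2
        field_simp

/-- For `d, e ≤ x^{1/4}` (`d, e ≥ 1`) and `x ≥ 64`: `x^{1/3} ≤ ⌊x/(de)⌋`. [folklore] -/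
private theorem rpow_third_le_div {x d e : ℕ} (hx : 64 ≤ x) (hd : 1 ≤ d) (he : 1 ≤ e)
    (hdy : (d : ℝ) ≤ (x : ℝ) ^ ((1 : ℝ) / 4)) (hey : (e : ℝ) ≤ (x : ℝ) ^ ((1 : ℝ) / 4)) :
    (x : ℝ) ^ ((1 : ℝ) / 3) ≤ ((x / (d * e) : ℕ) : ℝ) := by
  have hx0 : (0 : ℝ) < x := by exact_mod_cast (show 0 < x by omega)
  have hx1 : (1 : ℝ) ≤ x := by exact_mod_cast (show 1 ≤ x by omega)
  have hde0 : 0 < d * e := Nat.mul_pos (by omega) (by omega)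
  have hdeR : (0 : ℝ) < (d : ℝ) * e := by exact_mod_cast hde0
  -- `de ≤ x^{1/2}`
  have hde : (d : ℝ) * e ≤ (x : ℝ) ^ ((1 : ℝ) / 2) := by
    calc (d : ℝ) * e ≤ (x : ℝ) ^ ((1 : ℝ) / 4) * (x : ℝ) ^ ((1 : ℝ) / 4) :=
          mul_le_mul hdy hey (Nat.cast_nonneg _) (by positivity)
      _ = (x : ℝ) ^ ((1 : ℝ) / 2) := by rw [← Real.rpow_add hx0]; norm_num
  -- `⌊x/(de)⌋ ≥ x/(de) - 1 ≥ x^{1/2} - 1`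
  have hfloor : (x : ℝ) / (d * e) - 1 ≤ ((x / (d * e) : ℕ) : ℝ) := by
    have h1 : x < x / (d * e) * (d * e) + d * e := Nat.lt_div_mul_add hde0
    have h2 : (x : ℝ) < ((x / (d * e) : ℕ) : ℝ) * (d * e) + d * e := by exact_mod_cast h1
    rw [div_sub_one hdeR.ne', div_le_iff₀ hdeR]
    linarith
  have hhalf : (x : ℝ) ^ ((1 : ℝ) / 2) ≤ (x : ℝ) / (d * e) := by
    rw [le_div_iff₀ hdeR]
    calc (x : ℝ) ^ ((1 : ℝ) / 2) * (d * e) ≤ (x : ℝ) ^ ((1 : ℝ) / 2) * (x : ℝ) ^ ((1 : ℝ) / 2) :=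
          mul_le_mul_of_nonneg_left hde (by positivity)
      _ = x := by rw [← Real.rpow_add hx0]; norm_num
  -- `x^{1/2} - 1 ≥ x^{1/3}`: `x^{1/2} - x^{1/3} = x^{1/3}(x^{1/6} - 1) ≥ 1 · 1`
  have h6 : (2 : ℝ) ≤ (x : ℝ) ^ ((1 : ℝ) / 6) := by
    have h64 : ((2 : ℝ) ^ (6 : ℕ)) ≤ x := by norm_num; exact_mod_cast hx
    calc (2 : ℝ) = ((2 : ℝ) ^ (6 : ℕ)) ^ ((1 : ℝ) / 6) := by
          rw [← Real.rpow_natCast, ← Real.rpow_mul (by norm_num)]; norm_num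
      _ ≤ (x : ℝ) ^ ((1 : ℝ) / 6) := Real.rpow_le_rpow (by norm_num) h64 (by norm_num)
  have h3 : (1 : ℝ) ≤ (x : ℝ) ^ ((1 : ℝ) / 3) := Real.one_le_rpow hx1 (by norm_num)
  have hprod : (x : ℝ) ^ ((1 : ℝ) / 2) = (x : ℝ) ^ ((1 : ℝ) / 3) * (x : ℝ) ^ ((1 : ℝ) / 6) := by
    rw [← Real.rpow_add hx0]; norm_num
  have hkey : (x : ℝ) ^ ((1 : ℝ) / 3) + 1 ≤ (x : ℝ) ^ ((1 : ℝ) / 2) := by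
    rw [hprod]; nlinarith
  linarith

/-- The rough divisor-power sum with a sieving level possibly above the range: for `2 ≤ w` and `y ≥ 1`,
`∑_{d ≤ y, d w-rough} τ(d)^k/d ≤ max(C,1) (log X/log w)^{2^k}` whenever `log y ≤ log X`, `w ≤ X` and `C` is
the constant of `RoughSums.exists_sum_rough_sigma_zero_pow_div_le'`. [folklore] -/
theorem sum_rough_le_max {C : ℝ} {k : ℕ}
    (hR : ∀ z x : ℝ, 1 < z → z ≤ x →
      ∑ d ∈ (Icc 1 ⌊x⌋₊).filter (fun n => ∀ p ∈ n.primeFactors, z ≤ ((p : ℕ) : ℝ)),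
          ((σ 0 d : ℕ) : ℝ) ^ k / d ≤ C * (Real.log x / Real.log z) ^ 2 ^ k)
    {w y X : ℝ} (hw : 2 ≤ w) (hy : 1 ≤ y) (hyX : Real.log y ≤ Real.log X) (hwX : w ≤ X) :
    ∑ d ∈ (Icc 1 ⌊y⌋₊).filter (fun n => ∀ p ∈ n.primeFactors, w ≤ ((p : ℕ) : ℝ)),
        ((d.divisors.card : ℝ)) ^ k / d ≤ max C 1 * (Real.log X / Real.log w) ^ 2 ^ k := by
  have hlogw : 0 < Real.log w := Real.log_pos (by linarith)
  have hratio : 1 ≤ Real.log X / Real.log w := by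
    rw [le_div_iff₀ hlogw, one_mul]; exact Real.log_le_log (by linarith) hwX
  have hpow1 : 1 ≤ (Real.log X / Real.log w) ^ 2 ^ k := one_le_pow₀ hratio
  have hterm0 : ∀ d ∈ (Icc 1 ⌊y⌋₊).filter (fun n => ∀ p ∈ n.primeFactors, w ≤ ((p : ℕ) : ℝ)),
      0 ≤ ((d.divisors.card : ℝ)) ^ k / d := fun d _ => by positivity
  rcases le_or_gt w y with hwy | hwy
  · have h1 := hR w y (by linarith) hwy
    have hconv : ∑ d ∈ (Icc 1 ⌊y⌋₊).filter (fun n => ∀ p ∈ n.primeFactors, w ≤ ((p : ℕ) : ℝ)),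
        ((d.divisors.card : ℝ)) ^ k / d =
        ∑ d ∈ (Icc 1 ⌊y⌋₊).filter (fun n => ∀ p ∈ n.primeFactors, w ≤ ((p : ℕ) : ℝ)),
          ((σ 0 d : ℕ) : ℝ) ^ k / d := by
      refine Finset.sum_congr rfl fun d _ => ?_
      rw [ArithmeticFunction.sigma_zero_apply]
    rw [hconv]
    have hlogy : Real.log y / Real.log w ≤ Real.log X / Real.log w :=
      div_le_div_of_nonneg_right hyX hlogw.le
    have hlogy0 : 0 ≤ Real.log y / Real.log w := div_nonneg (Real.log_nonneg hy) hlogw.le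
    calc _ ≤ C * (Real.log y / Real.log w) ^ 2 ^ k := h1
      _ ≤ max C 1 * (Real.log y / Real.log w) ^ 2 ^ k :=
          mul_le_mul_of_nonneg_right (le_max_left _ _) (by positivity)
      _ ≤ max C 1 * (Real.log X / Real.log w) ^ 2 ^ k :=
          mul_le_mul_of_nonneg_left (pow_le_pow_left₀ hlogy0 hlogy _) (le_trans zero_le_one (le_max_right _ _))
  · -- `y < w`: only `d = 1` is counted
    have hsub : (Icc 1 ⌊y⌋₊).filter (fun n => ∀ p ∈ n.primeFactors, w ≤ ((p : ℕ) : ℝ)) ⊆ {1} := by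
      intro d hd
      rw [Finset.mem_filter, Finset.mem_Icc] at hd
      rw [Finset.mem_singleton]
      by_contra hd1
      have hp := Nat.minFac_prime hd1
      have hpd : d.minFac ∈ d.primeFactors := Nat.mem_primeFactors.mpr ⟨hp, Nat.minFac_dvd d, by omega⟩
      have h1 : w ≤ (d.minFac : ℝ) := hd.2 _ hpd
      have h2 : (d.minFac : ℝ) ≤ d := by exact_mod_cast Nat.minFac_le (by omega)
      have h3 : (d : ℝ) ≤ y := by
        have := Nat.floor_le (show (0 : ℝ) ≤ y by linarith)
        exact le_trans (by exact_mod_cast hd.1.2) this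
      linarith
    calc ∑ d ∈ (Icc 1 ⌊y⌋₊).filter (fun n => ∀ p ∈ n.primeFactors, w ≤ ((p : ℕ) : ℝ)),
          ((d.divisors.card : ℝ)) ^ k / d
        ≤ ∑ d ∈ ({1} : Finset ℕ), ((d.divisors.card : ℝ)) ^ k / d :=
          Finset.sum_le_sum_of_subset_of_nonneg hsub fun d _ _ => by positivity
      _ = 1 := by simp
      _ ≤ max C 1 * (Real.log X / Real.log w) ^ 2 ^ k := by
          calc (1 : ℝ) = 1 * 1 := by ring
            _ ≤ max C 1 * (Real.log X / Real.log w) ^ 2 ^ k :=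
                mul_le_mul (le_max_right _ _) hpow1 zero_le_one (le_trans zero_le_one (le_max_right _ _))


/-! ### The theorem -/

/-- `mn + h ≤ x^{B+2}` for `n ≤ x`, `m, h ≤ x^B`, `x ≥ 2`. [folklore] -/
private theorem linear_le_pow {x m h B n : ℕ} (hx : 2 ≤ x) (hmB : (m : ℝ) ≤ (x : ℝ) ^ B)
    (hhB : (h : ℝ) ≤ (x : ℝ) ^ B) (hn : n ≤ x) : ((m * n + h : ℕ) : ℝ) ≤ (x : ℝ) ^ (B + 2) := by
  have hx2 : (2 : ℝ) ≤ x := by exact_mod_cast hx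
  have hn' : (n : ℝ) ≤ x := by exact_mod_cast hn
  have hxB : (0 : ℝ) ≤ (x : ℝ) ^ B := by positivity
  have h1 : (m : ℝ) * n ≤ (x : ℝ) ^ B * x := mul_le_mul hmB hn' (Nat.cast_nonneg _) hxB
  have h3 : (x : ℝ) + 1 ≤ x * x := by nlinarith
  have h2 : (x : ℝ) ^ B * x + (x : ℝ) ^ B ≤ (x : ℝ) ^ (B + 2) := by
    have e : (x : ℝ) ^ (B + 2) = (x : ℝ) ^ B * (x * x) := by ring
    rw [e]
    nlinarith
  push_cast
  linarith

/-- The double-sum bookkeeping behind Lemma 3.1(i): if each pair count is at most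
`1_{I₁(d)} 1_{I₂(e)} (G τ(d)³ τ(e)³ (x/(de))/L + 1)`, then
`∑_d ∑_e τ(d)^{M₁} τ(e)^{M₂} cnt(d,e) ≤ (G x/L) (∑_{I₁} τ^{M₁+3}/d)(∑_{I₂} τ^{M₂+3}/e) + (∑ τ^{M₁})(∑ τ^{M₂})`.
[folklore] -/
theorem double_sum_le (D : Finset ℕ) (τ : ℕ → ℝ) (I₁ I₂ : ℕ → Prop) [DecidablePred I₁]
    [DecidablePred I₂] (cnt : ℕ → ℕ → ℝ) (M₁ M₂ : ℕ) {G x L : ℝ}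
    (hL : 0 < L) (hτ : ∀ d ∈ D, 0 ≤ τ d) (hD : ∀ d ∈ D, (0 : ℝ) < d)
    (hcnt : ∀ d ∈ D, ∀ e ∈ D, cnt d e ≤
      (if I₁ d ∧ I₂ e then 1 else 0) * (G * (τ d ^ 3 * τ e ^ 3) * (x / (d * e)) / L + 1)) :
    ∑ d ∈ D, ∑ e ∈ D, τ d ^ M₁ * τ e ^ M₂ * cnt d e ≤
      G * x / L * ((∑ d ∈ D.filter I₁, τ d ^ (M₁ + 3) / d) *
          (∑ e ∈ D.filter I₂, τ e ^ (M₂ + 3) / e)) +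
        (∑ d ∈ D, τ d ^ M₁) * (∑ e ∈ D, τ e ^ M₂) := by
  rw [Finset.sum_filter, Finset.sum_filter]
  have hpoint : ∀ d ∈ D, ∀ e ∈ D, τ d ^ M₁ * τ e ^ M₂ * cnt d e ≤
      G * x / L * ((if I₁ d then τ d ^ (M₁ + 3) / d else 0) *
          (if I₂ e then τ e ^ (M₂ + 3) / e else 0)) + τ d ^ M₁ * τ e ^ M₂ := by
    intro d hd e he
    have hd0 : (d : ℝ) ≠ 0 := (hD d hd).ne'
    have he0 : (e : ℝ) ≠ 0 := (hD e he).ne'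
    have hL0 : L ≠ 0 := hL.ne'
    have hτd := hτ d hd
    have hτe := hτ e he
    have h0 : 0 ≤ τ d ^ M₁ * τ e ^ M₂ := mul_nonneg (pow_nonneg hτd _) (pow_nonneg hτe _)
    refine (mul_le_mul_of_nonneg_left (hcnt d hd e he) h0).trans ?_
    by_cases c1 : I₁ d
    · by_cases c2 : I₂ e
      · rw [if_pos ⟨c1, c2⟩, if_pos c1, if_pos c2]
        apply le_of_eq
        field_simp
        ring
      · rw [if_neg (fun h => c2 h.2), if_pos c1, if_neg c2]
        simp only [zero_mul, mul_zero, zero_add]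
        exact h0
    · rw [if_neg (fun h => c1 h.1), if_neg c1]
      simp only [zero_mul, mul_zero, zero_add]
      exact h0
  calc ∑ d ∈ D, ∑ e ∈ D, τ d ^ M₁ * τ e ^ M₂ * cnt d e
      ≤ ∑ d ∈ D, ∑ e ∈ D, (G * x / L * ((if I₁ d then τ d ^ (M₁ + 3) / d else 0) *
          (if I₂ e then τ e ^ (M₂ + 3) / e else 0)) + τ d ^ M₁ * τ e ^ M₂) :=
        Finset.sum_le_sum fun d hd => Finset.sum_le_sum fun e he => hpoint d hd e he
    _ = _ := by
        rw [Finset.sum_mul_sum, Finset.sum_mul_sum, Finset.mul_sum, ← Finset.sum_add_distrib]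
        refine Finset.sum_congr rfl fun d _ => ?_
        rw [Finset.mul_sum, ← Finset.sum_add_distrib]

set_option maxHeartbeats 800000 in
/-- The case `x ≥ 4096` of `sum_pow_card_divisors_le`, with all the auxiliary constants explicit:
`C₀` is the pair-sieve constant, `(C₁, M₁), (C₂, M₂)` come from Landreau's inequality, `C₃, C₄` from the
rough divisor-power sums, `C₅, C₆` from the plain divisor-power sums and `K₇` from `log^c x ≤ K₇ √x`.
[cite: MatomakiMerikoski2023, Lemma 3.1(i)] -/
theorem sum_pow_card_divisors_le_of_large {a b B M₁ M₂ : ℕ} {C₀ C₁ C₂ C₃ C₄ C₅ C₆ K₇ : ℝ}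
    (hC₀ : 0 < C₀) (hC₁ : 0 < C₁) (hC₂ : 0 < C₂) (hC₅ : 0 ≤ C₅) (hC₆ : 0 ≤ C₆)
    (HS : ∀ (K α₁ β₁ α₂ β₂ : ℕ), 1 ≤ α₁ → 1 ≤ α₂ → PairLinearSieve.det α₁ β₁ α₂ β₂ ≠ 0 →
      ∀ w₁ w₂ : ℝ, 2 ≤ w₁ → w₁ ≤ K → 2 ≤ w₂ → w₂ ≤ K →
      (#{k ∈ Icc 1 K | (∀ p ∈ (α₁ * k + β₁).primeFactors, w₁ ≤ (p : ℝ)) ∧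
          (∀ p ∈ (α₂ * k + β₂).primeFactors, w₂ ≤ (p : ℝ) ∨ p ∣ α₂ * PairLinearSieve.det α₁ β₁ α₂ β₂)} : ℝ) ≤
        C₀ * ((α₁ : ℝ) / Nat.totient α₁) *
          (((α₂ * PairLinearSieve.det α₁ β₁ α₂ β₂ : ℕ) : ℝ) /
            Nat.totient (α₂ * PairLinearSieve.det α₁ β₁ α₂ β₂)) * (K : ℝ) / (Real.log w₁ * Real.log w₂))
    (hL₁ : ∀ (X : ℝ) (n : ℕ), n ≠ 0 → (n : ℝ) ≤ X → ((n.divisors.card : ℝ)) ^ a ≤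
      C₁ * ∑ d ∈ Icc 1 ⌊X ^ (1 / 4 : ℝ)⌋₊, if d ∣ n then ((d.divisors.card : ℕ) : ℝ) ^ M₁ else 0)
    (hL₂ : ∀ (X : ℝ) (n : ℕ), n ≠ 0 → (n : ℝ) ≤ X → ((n.divisors.card : ℝ)) ^ b ≤
      C₂ * ∑ d ∈ Icc 1 ⌊X ^ (1 / (4 * ((B : ℝ) + 2)))⌋₊,
        if d ∣ n then ((d.divisors.card : ℕ) : ℝ) ^ M₂ else 0)
    (hR₁ : ∀ z x : ℝ, 1 < z → z ≤ x →
      ∑ d ∈ (Icc 1 ⌊x⌋₊).filter (fun n => ∀ p ∈ n.primeFactors, z ≤ ((p : ℕ) : ℝ)),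
          ((σ 0 d : ℕ) : ℝ) ^ (M₁ + 3) / d ≤ C₃ * (Real.log x / Real.log z) ^ 2 ^ (M₁ + 3))
    (hR₂ : ∀ z x : ℝ, 1 < z → z ≤ x →
      ∑ d ∈ (Icc 1 ⌊x⌋₊).filter (fun n => ∀ p ∈ n.primeFactors, z ≤ ((p : ℕ) : ℝ)),
          ((σ 0 d : ℕ) : ℝ) ^ (M₂ + 3) / d ≤ C₄ * (Real.log x / Real.log z) ^ 2 ^ (M₂ + 3))
    (hP₁ : ∀ y : ℝ, 2 ≤ y → ∑ n ∈ Icc 1 ⌊y⌋₊, (σ 0 n : ℝ) ^ M₁ ≤ C₅ * y * Real.log y ^ 2 ^ (M₁ + 1))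
    (hP₂ : ∀ y : ℝ, 2 ≤ y → ∑ n ∈ Icc 1 ⌊y⌋₊, (σ 0 n : ℝ) ^ M₂ ≤ C₆ * y * Real.log y ^ 2 ^ (M₂ + 1))
    (hlog : ∀ x : ℝ, 1 ≤ x → Real.log x ^ (2 ^ (M₁ + 1) + 2 ^ (M₂ + 1) + 2) ≤ K₇ * Real.sqrt x)
    {x m h : ℕ} (hx : 4096 ≤ x) (hm : 1 ≤ m) (hh : 1 ≤ h) (hmB : (m : ℝ) ≤ (x : ℝ) ^ B)
    (hhB : (h : ℝ) ≤ (x : ℝ) ^ B) (hmh : Nat.Coprime m h) {w₁ w₂ : ℝ} (hw₁ : 2 ≤ w₁)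
    (hw₁x : w₁ ≤ x) (hw₂ : 2 ≤ w₂) (hw₂x : w₂ ≤ x) :
    ∑ n ∈ (Icc 1 x).filter (fun n : ℕ => Nat.Coprime n h ∧ (∀ p ∈ n.primeFactors, w₁ ≤ (p : ℝ)) ∧
        (∀ p ∈ (m * n + h).primeFactors, w₂ ≤ (p : ℝ))),
        ((n.divisors.card : ℝ)) ^ a * (((m * n + h).divisors.card : ℝ)) ^ b ≤
      9 * C₀ * C₁ * C₂ * max C₃ 1 * max C₄ 1 * (((m : ℝ) / Nat.totient m) * ((h : ℝ) / Nat.totient h)) *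
          x / (Real.log w₁ * Real.log w₂) *
          ((Real.log x / Real.log w₁) ^ 2 ^ (M₁ + 3) * (Real.log x / Real.log w₂) ^ 2 ^ (M₂ + 3)) +
        C₁ * C₂ * C₅ * C₆ * K₇ * ((x : ℝ) / Real.log x ^ 2) := by
  -- names
  set A := (Icc 1 x).filter (fun n : ℕ => Nat.Coprime n h ∧ (∀ p ∈ n.primeFactors, w₁ ≤ (p : ℝ)) ∧
      (∀ p ∈ (m * n + h).primeFactors, w₂ ≤ (p : ℝ))) with hA
  obtain ⟨F, hF⟩ : ∃ F : ℝ, F = ((m : ℝ) / Nat.totient m) * ((h : ℝ) / Nat.totient h) := ⟨_, rfl⟩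
  obtain ⟨L, hL⟩ : ∃ L : ℝ, L = Real.log w₁ * Real.log w₂ := ⟨_, rfl⟩
  obtain ⟨r₁, hr₁⟩ : ∃ r : ℝ, r = Real.log x / Real.log w₁ := ⟨_, rfl⟩
  obtain ⟨r₂, hr₂⟩ : ∃ r : ℝ, r = Real.log x / Real.log w₂ := ⟨_, rfl⟩
  rw [← hF, ← hL, ← hr₁, ← hr₂]
  have hm0 : m ≠ 0 := by omega
  have hh0 : h ≠ 0 := by omega
  have hx0 : (0 : ℝ) < x := by exact_mod_cast (show 0 < x by omega)
  have hx1 : (1 : ℝ) ≤ x := by exact_mod_cast (show 1 ≤ x by omega)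
  have hlogx : 0 < Real.log x := Real.log_pos (by exact_mod_cast (show 1 < x by omega))
  have hlogw₁ : 0 < Real.log w₁ := Real.log_pos (by linarith)
  have hlogw₂ : 0 < Real.log w₂ := Real.log_pos (by linarith)
  have hL0 : 0 < L := by rw [hL]; exact mul_pos hlogw₁ hlogw₂
  have hF0 : 0 < F := by
    rw [hF]
    exact mul_pos (lt_of_lt_of_le one_pos (one_le_self_div_totient hm0))
      (lt_of_lt_of_le one_pos (one_le_self_div_totient hh0))
  have hr₁0 : 0 ≤ r₁ := by rw [hr₁]; exact div_nonneg hlogx.le hlogw₁.le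
  have hr₂0 : 0 ≤ r₂ := by rw [hr₂]; exact div_nonneg hlogx.le hlogw₂.le
  -- `y = x^{1/4} ≥ 8`
  obtain ⟨y, hy⟩ : ∃ y : ℝ, y = (x : ℝ) ^ ((1 : ℝ) / 4) := ⟨_, rfl⟩
  have hy0 : 0 < y := by rw [hy]; positivity
  have hy8 : 8 ≤ y := by
    have h4096 : ((2 : ℝ) ^ (12 : ℕ)) ≤ x := by norm_num; exact_mod_cast hx
    rw [hy]
    calc (8 : ℝ) = ((2 : ℝ) ^ (12 : ℕ)) ^ ((1 : ℝ) / 4) := by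
          rw [← Real.rpow_natCast, ← Real.rpow_mul (by norm_num)]; norm_num
      _ ≤ (x : ℝ) ^ ((1 : ℝ) / 4) := Real.rpow_le_rpow (by norm_num) h4096 (by norm_num)
  have hy2 : 2 ≤ y := by linarith
  have hy1 : 1 ≤ y := by linarith
  have hlogy : Real.log y = Real.log x / 4 := by rw [hy, Real.log_rpow hx0]; ring
  have hlogyx : Real.log y ≤ Real.log x := by rw [hlogy]; linarith
  have hlogy0 : 0 ≤ Real.log y := by rw [hlogy]; positivity
  have hysq : y ^ 2 = Real.sqrt x := by
    rw [hy, ← Real.rpow_natCast, ← Real.rpow_mul hx0.le, Real.sqrt_eq_rpow]; norm_num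
  have hmemD : ∀ d ∈ Icc 1 ⌊y⌋₊, 1 ≤ d ∧ (d : ℝ) ≤ y := by
    intro d hd
    rw [Finset.mem_Icc] at hd
    exact ⟨hd.1, le_trans (by exact_mod_cast hd.2) (Nat.floor_le hy0.le)⟩
  have hD0 : ∀ d ∈ Icc 1 ⌊y⌋₊, (0 : ℝ) < d := fun d hd => by exact_mod_cast (hmemD d hd).1
  -- Step A: Landreau's inequality for both factors
  have hXε : ((x : ℝ) ^ ((B : ℝ) + 2)) ^ (1 / (4 * ((B : ℝ) + 2))) = y := by
    rw [hy, ← Real.rpow_mul hx0.le]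
    congr 1
    field_simp
  have hXeq : (x : ℝ) ^ ((B : ℝ) + 2) = (x : ℝ) ^ (B + 2) := by
    rw [show ((B : ℝ) + 2) = ((B + 2 : ℕ) : ℝ) by push_cast; ring, Real.rpow_natCast]
  have hstepA : ∀ n ∈ A, ((n.divisors.card : ℝ)) ^ a * (((m * n + h).divisors.card : ℝ)) ^ b ≤
      (C₁ * C₂) * ((∑ d ∈ Icc 1 ⌊y⌋₊, if d ∣ n then ((d.divisors.card : ℕ) : ℝ) ^ M₁ else 0) *
        (∑ e ∈ Icc 1 ⌊y⌋₊, if e ∣ m * n + h then ((e.divisors.card : ℕ) : ℝ) ^ M₂ else 0)) := by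
    intro n hn
    have hn' : n ∈ Icc 1 x := (Finset.mem_filter.mp hn).1
    rw [Finset.mem_Icc] at hn'
    have hn0 : n ≠ 0 := by omega
    have h1 := hL₁ (x : ℝ) n hn0 (by exact_mod_cast hn'.2)
    rw [← hy] at h1
    have h2 := hL₂ ((x : ℝ) ^ ((B : ℝ) + 2)) (m * n + h) (by positivity)
      (by rw [hXeq]; exact linear_le_pow (by omega) hmB hhB hn'.2)
    rw [hXε] at h2
    have hs1 : 0 ≤ ∑ d ∈ Icc 1 ⌊y⌋₊, if d ∣ n then ((d.divisors.card : ℕ) : ℝ) ^ M₁ else 0 :=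
      Finset.sum_nonneg fun d _ => by split_ifs <;> positivity
    have hτb : 0 ≤ (((m * n + h).divisors.card : ℝ)) ^ b := by positivity
    calc ((n.divisors.card : ℝ)) ^ a * (((m * n + h).divisors.card : ℝ)) ^ b
        ≤ (C₁ * ∑ d ∈ Icc 1 ⌊y⌋₊, if d ∣ n then ((d.divisors.card : ℕ) : ℝ) ^ M₁ else 0) *
          (C₂ * ∑ e ∈ Icc 1 ⌊y⌋₊, if e ∣ m * n + h then ((e.divisors.card : ℕ) : ℝ) ^ M₂ else 0) :=
          mul_le_mul h1 h2 hτb (mul_nonneg hC₁.le hs1)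
      _ = _ := by ring
  -- Step B: swap the summations
  have hswap : ∑ n ∈ A, (∑ d ∈ Icc 1 ⌊y⌋₊, if d ∣ n then ((d.divisors.card : ℕ) : ℝ) ^ M₁ else 0) *
      (∑ e ∈ Icc 1 ⌊y⌋₊, if e ∣ m * n + h then ((e.divisors.card : ℕ) : ℝ) ^ M₂ else 0) =
      ∑ d ∈ Icc 1 ⌊y⌋₊, ∑ e ∈ Icc 1 ⌊y⌋₊, ((d.divisors.card : ℕ) : ℝ) ^ M₁ *
        ((e.divisors.card : ℕ) : ℝ) ^ M₂ * #{n ∈ A | d ∣ n ∧ e ∣ m * n + h} :=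
    sum_mul_sum_indicator_eq A (Icc 1 ⌊y⌋₊) (Icc 1 ⌊y⌋₊) (fun d => ((d.divisors.card : ℕ) : ℝ) ^ M₁)
      (fun e => ((e.divisors.card : ℕ) : ℝ) ^ M₂) (fun n => m * n + h)
  have hstepB : ∑ n ∈ A, ((n.divisors.card : ℝ)) ^ a * (((m * n + h).divisors.card : ℝ)) ^ b ≤
      (C₁ * C₂) * ∑ d ∈ Icc 1 ⌊y⌋₊, ∑ e ∈ Icc 1 ⌊y⌋₊, ((d.divisors.card : ℕ) : ℝ) ^ M₁ *
        ((e.divisors.card : ℕ) : ℝ) ^ M₂ * #{n ∈ A | d ∣ n ∧ e ∣ m * n + h} := by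
    rw [← hswap, Finset.mul_sum]
    exact Finset.sum_le_sum hstepA
  -- Step C: the count for each pair `(d, e)`
  have hstepC : ∀ d ∈ Icc 1 ⌊y⌋₊, ∀ e ∈ Icc 1 ⌊y⌋₊, (#{n ∈ A | d ∣ n ∧ e ∣ m * n + h} : ℝ) ≤
      (if (∀ p ∈ d.primeFactors, w₁ ≤ (p : ℝ)) ∧ (∀ p ∈ e.primeFactors, w₂ ≤ (p : ℝ)) then 1 else 0) *
        ((9 * C₀ * F) * (((d.divisors.card : ℝ)) ^ 3 * ((e.divisors.card : ℝ)) ^ 3) *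
          ((x : ℝ) / (d * e)) / L + 1) := by
    intro d hd e he
    obtain ⟨hd1, hdy⟩ := hmemD d hd
    obtain ⟨he1, hey⟩ := hmemD e he
    have hK := rpow_third_le_div (x := x) (by omega) hd1 he1 (by rw [← hy]; exact hdy)
      (by rw [← hy]; exact hey)
    have hc := count_pair_le hC₀ HS (by omega) hm hh hmh hd1 he1 hK hw₁ hw₁x hw₂ hw₂x
    rw [← hF, ← hL] at hc
    have hset : {n ∈ A | d ∣ n ∧ e ∣ m * n + h} =
        {n ∈ Icc 1 x | (Nat.Coprime n h ∧ (∀ p ∈ n.primeFactors, w₁ ≤ (p : ℝ)) ∧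
          (∀ p ∈ (m * n + h).primeFactors, w₂ ≤ (p : ℝ))) ∧ (d ∣ n ∧ e ∣ m * n + h)} := by
      rw [hA, Finset.filter_filter]
    rw [hset]
    exact hc
  -- Step D: sum over the pairs
  have hstepD : ∑ d ∈ Icc 1 ⌊y⌋₊, ∑ e ∈ Icc 1 ⌊y⌋₊, ((d.divisors.card : ℕ) : ℝ) ^ M₁ *
      ((e.divisors.card : ℕ) : ℝ) ^ M₂ * (#{n ∈ A | d ∣ n ∧ e ∣ m * n + h} : ℝ) ≤
      (9 * C₀ * F) * x / L *
        ((∑ d ∈ (Icc 1 ⌊y⌋₊).filter (fun d : ℕ => ∀ p ∈ d.primeFactors, w₁ ≤ (p : ℝ)),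
            ((d.divisors.card : ℝ)) ^ (M₁ + 3) / d) *
          (∑ e ∈ (Icc 1 ⌊y⌋₊).filter (fun e : ℕ => ∀ p ∈ e.primeFactors, w₂ ≤ (p : ℝ)),
            ((e.divisors.card : ℝ)) ^ (M₂ + 3) / e)) +
        (∑ d ∈ Icc 1 ⌊y⌋₊, ((d.divisors.card : ℝ)) ^ M₁) *
          (∑ e ∈ Icc 1 ⌊y⌋₊, ((e.divisors.card : ℝ)) ^ M₂) :=
    double_sum_le (Icc 1 ⌊y⌋₊) (fun d => (d.divisors.card : ℝ))
      (fun d : ℕ => ∀ p ∈ d.primeFactors, w₁ ≤ (p : ℝ)) (fun e : ℕ => ∀ p ∈ e.primeFactors, w₂ ≤ (p : ℝ))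
      (fun d e => (#{n ∈ A | d ∣ n ∧ e ∣ m * n + h} : ℝ)) M₁ M₂
      hL0 (fun d _ => Nat.cast_nonneg _) hD0 hstepC
  -- Step E: the one-dimensional sums
  have hU : ∑ d ∈ (Icc 1 ⌊y⌋₊).filter (fun d : ℕ => ∀ p ∈ d.primeFactors, w₁ ≤ (p : ℝ)),
      ((d.divisors.card : ℝ)) ^ (M₁ + 3) / d ≤ max C₃ 1 * r₁ ^ 2 ^ (M₁ + 3) := by
    rw [hr₁]; exact sum_rough_le_max hR₁ hw₁ hy1 hlogyx hw₁x
  have hV : ∑ e ∈ (Icc 1 ⌊y⌋₊).filter (fun e : ℕ => ∀ p ∈ e.primeFactors, w₂ ≤ (p : ℝ)),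
      ((e.divisors.card : ℝ)) ^ (M₂ + 3) / e ≤ max C₄ 1 * r₂ ^ 2 ^ (M₂ + 3) := by
    rw [hr₂]; exact sum_rough_le_max hR₂ hw₂ hy1 hlogyx hw₂x
  have hP₁' : ∑ d ∈ Icc 1 ⌊y⌋₊, ((d.divisors.card : ℝ)) ^ M₁ ≤ C₅ * y * Real.log y ^ 2 ^ (M₁ + 1) := by
    have h := hP₁ y hy2
    simp only [ArithmeticFunction.sigma_zero_apply] at h
    exact h
  have hP₂' : ∑ e ∈ Icc 1 ⌊y⌋₊, ((e.divisors.card : ℝ)) ^ M₂ ≤ C₆ * y * Real.log y ^ 2 ^ (M₂ + 1) := by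
    have h := hP₂ y hy2
    simp only [ArithmeticFunction.sigma_zero_apply] at h
    exact h
  set U := ∑ d ∈ (Icc 1 ⌊y⌋₊).filter (fun d : ℕ => ∀ p ∈ d.primeFactors, w₁ ≤ (p : ℝ)),
      ((d.divisors.card : ℝ)) ^ (M₁ + 3) / d with hUdef
  set V := ∑ e ∈ (Icc 1 ⌊y⌋₊).filter (fun e : ℕ => ∀ p ∈ e.primeFactors, w₂ ≤ (p : ℝ)),
      ((e.divisors.card : ℝ)) ^ (M₂ + 3) / e with hVdef
  set P₁ := ∑ d ∈ Icc 1 ⌊y⌋₊, ((d.divisors.card : ℝ)) ^ M₁ with hP₁def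
  set P₂ := ∑ e ∈ Icc 1 ⌊y⌋₊, ((e.divisors.card : ℝ)) ^ M₂ with hP₂def
  have hU0 : 0 ≤ U := Finset.sum_nonneg fun d _ => by positivity
  have hV0 : 0 ≤ V := Finset.sum_nonneg fun e _ => by positivity
  have hP₁0 : 0 ≤ P₁ := Finset.sum_nonneg fun d _ => by positivity
  -- main part
  have hmain : (C₁ * C₂) * ((9 * C₀ * F) * x / L * (U * V)) ≤
      9 * C₀ * C₁ * C₂ * max C₃ 1 * max C₄ 1 * F * x / L * (r₁ ^ 2 ^ (M₁ + 3) * r₂ ^ 2 ^ (M₂ + 3)) := by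
    have hM₄ : 0 ≤ max C₄ 1 * r₂ ^ 2 ^ (M₂ + 3) :=
      mul_nonneg (le_max_of_le_right zero_le_one) (pow_nonneg hr₂0 _)
    have h1 : U * V ≤ (max C₃ 1 * r₁ ^ 2 ^ (M₁ + 3)) * (max C₄ 1 * r₂ ^ 2 ^ (M₂ + 3)) :=
      mul_le_mul hU hV hV0 (hU0.trans hU)
    have h2 : 0 ≤ (C₁ * C₂) * ((9 * C₀ * F) * x / L) := by positivity
    calc (C₁ * C₂) * ((9 * C₀ * F) * x / L * (U * V))
        = (C₁ * C₂) * ((9 * C₀ * F) * x / L) * (U * V) := by ring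
      _ ≤ (C₁ * C₂) * ((9 * C₀ * F) * x / L) *
          ((max C₃ 1 * r₁ ^ 2 ^ (M₁ + 3)) * (max C₄ 1 * r₂ ^ 2 ^ (M₂ + 3))) :=
          mul_le_mul_of_nonneg_left h1 h2
      _ = _ := by ring
  -- remainder part
  have hrem : (C₁ * C₂) * (P₁ * P₂) ≤ C₁ * C₂ * C₅ * C₆ * K₇ * ((x : ℝ) / Real.log x ^ 2) := by
    have h1 : P₁ * P₂ ≤ (C₅ * y * Real.log y ^ 2 ^ (M₁ + 1)) * (C₆ * y * Real.log y ^ 2 ^ (M₂ + 1)) :=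
      mul_le_mul hP₁' hP₂' (Finset.sum_nonneg fun _ _ => by positivity) (by positivity)
    have e1 : (C₅ * y * Real.log y ^ 2 ^ (M₁ + 1)) * (C₆ * y * Real.log y ^ 2 ^ (M₂ + 1)) =
        C₅ * C₆ * (y ^ 2 * Real.log y ^ (2 ^ (M₁ + 1) + 2 ^ (M₂ + 1))) := by ring
    have e2 : Real.log y ^ (2 ^ (M₁ + 1) + 2 ^ (M₂ + 1)) ≤ Real.log x ^ (2 ^ (M₁ + 1) + 2 ^ (M₂ + 1)) :=
      pow_le_pow_left₀ hlogy0 hlogyx _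
    have e3 : Real.sqrt x * Real.log x ^ (2 ^ (M₁ + 1) + 2 ^ (M₂ + 1)) ≤
        K₇ * ((x : ℝ) / Real.log x ^ 2) := by
      have hc := hlog x hx1
      rw [mul_div_assoc', le_div_iff₀ (by positivity)]
      calc Real.sqrt x * Real.log x ^ (2 ^ (M₁ + 1) + 2 ^ (M₂ + 1)) * Real.log x ^ 2
          = Real.sqrt x * Real.log x ^ (2 ^ (M₁ + 1) + 2 ^ (M₂ + 1) + 2) := by ring
        _ ≤ Real.sqrt x * (K₇ * Real.sqrt x) := mul_le_mul_of_nonneg_left hc (Real.sqrt_nonneg _)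
        _ = K₇ * x := by rw [mul_left_comm, Real.mul_self_sqrt hx0.le]
    have h2 : (C₅ * y * Real.log y ^ 2 ^ (M₁ + 1)) * (C₆ * y * Real.log y ^ 2 ^ (M₂ + 1)) ≤
        C₅ * C₆ * (K₇ * ((x : ℝ) / Real.log x ^ 2)) := by
      rw [e1]
      refine mul_le_mul_of_nonneg_left ?_ (mul_nonneg hC₅ hC₆)
      rw [hysq]
      exact (mul_le_mul_of_nonneg_left e2 (Real.sqrt_nonneg _)).trans e3
    calc (C₁ * C₂) * (P₁ * P₂) ≤ (C₁ * C₂) * (C₅ * C₆ * (K₇ * ((x : ℝ) / Real.log x ^ 2))) :=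
          mul_le_mul_of_nonneg_left (h1.trans h2) (by positivity)
      _ = _ := by ring
  -- assemble
  calc ∑ n ∈ A, ((n.divisors.card : ℝ)) ^ a * (((m * n + h).divisors.card : ℝ)) ^ b
      ≤ (C₁ * C₂) * ∑ d ∈ Icc 1 ⌊y⌋₊, ∑ e ∈ Icc 1 ⌊y⌋₊, ((d.divisors.card : ℕ) : ℝ) ^ M₁ *
          ((e.divisors.card : ℕ) : ℝ) ^ M₂ * #{n ∈ A | d ∣ n ∧ e ∣ m * n + h} := hstepB
    _ ≤ (C₁ * C₂) * ((9 * C₀ * F) * x / L * (U * V) + P₁ * P₂) :=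
        mul_le_mul_of_nonneg_left hstepD (by positivity)
    _ = (C₁ * C₂) * ((9 * C₀ * F) * x / L * (U * V)) + (C₁ * C₂) * (P₁ * P₂) := by ring
    _ ≤ _ := add_le_add hmain hrem

set_option maxHeartbeats 800000 in
/-- **Matomäki–Merikoski Lemma 3.1(i), coarse form, for a general linear form.**  For all `a, b, B` there
are `C > 0` and `κ` such that for all naturals `x ≥ 2`, coprime `m, h ≥ 1` with `m, h ≤ x^B`, and all
`2 ≤ w₁, w₂ ≤ x`:
`∑_{n ≤ x, (n,h)=1, n w₁-rough, mn+h w₂-rough} τ(n)^a τ(mn+h)^b ≤ C (m/φ(m))(h/φ(h)) x/(log w₁ log w₂) (log x/log w₁)^κ (log x/log w₂)^κ`.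
(The source's Lemma 3.1(i) is the case `m = 1`, with the sharp exponents `2^{a} + 1, 2^{b}` in place of
`κ + 1, κ` and with `(log X / log w₂)^{2^b}` — there `X` the size of the shifts; here the exponents come
from Landreau's inequality and are not sharp, which is harmless in the "long" ranges where the lemma is
used.) [cite: MatomakiMerikoski2023, Lemma 3.1(i)]; cf. [cite: Henriot2012, Thm 3]. -/
theorem sum_pow_card_divisors_le (a b B : ℕ) : ∃ C : ℝ, 0 < C ∧ ∃ κ : ℕ, ∀ (x m h : ℕ), 2 ≤ x →
    1 ≤ m → 1 ≤ h → (m : ℝ) ≤ (x : ℝ) ^ B → (h : ℝ) ≤ (x : ℝ) ^ B → Nat.Coprime m h →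
      ∀ w₁ w₂ : ℝ, 2 ≤ w₁ → w₁ ≤ x → 2 ≤ w₂ → w₂ ≤ x →
        ∑ n ∈ (Icc 1 x).filter (fun n : ℕ => Nat.Coprime n h ∧ (∀ p ∈ n.primeFactors, w₁ ≤ (p : ℝ)) ∧
            (∀ p ∈ (m * n + h).primeFactors, w₂ ≤ (p : ℝ))),
          ((n.divisors.card : ℝ)) ^ a * (((m * n + h).divisors.card : ℝ)) ^ b ≤
        C * (((m : ℝ) / Nat.totient m) * ((h : ℝ) / Nat.totient h)) * (x : ℝ) /
            (Real.log w₁ * Real.log w₂) *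
          ((Real.log x / Real.log w₁) ^ κ * (Real.log x / Real.log w₂) ^ κ) := by
  obtain ⟨C₁, hC₁, M₁, hL₁⟩ := card_divisors_pow_le_sum_Icc (show (0 : ℝ) < 1 / 4 by norm_num) a
  obtain ⟨C₂, hC₂, M₂, hL₂⟩ := card_divisors_pow_le_sum_Icc
    (show (0 : ℝ) < 1 / (4 * ((B : ℝ) + 2)) by positivity) b
  obtain ⟨C₀, hC₀, HS⟩ := PairLinearSieve.card_sifted_le
  obtain ⟨C₃, -, hR₁⟩ := RoughSums.exists_sum_rough_sigma_zero_pow_div_le' (M₁ + 3)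
  obtain ⟨C₄, -, hR₂⟩ := RoughSums.exists_sum_rough_sigma_zero_pow_div_le' (M₂ + 3)
  obtain ⟨C₅, hC₅, hP₁⟩ := exists_sum_sigma_zero_pow_le_real M₁
  obtain ⟨C₆, hC₆, hP₂⟩ := exists_sum_sigma_zero_pow_le_real M₂
  obtain ⟨K₇, hK₇, hlog⟩ := log_pow_le_mul_sqrt (2 ^ (M₁ + 1) + 2 ^ (M₂ + 1) + 2)
  obtain ⟨κ, hκ⟩ : ∃ κ : ℕ, κ = 2 ^ (M₁ + 3) + 2 ^ (M₂ + 3) := ⟨_, rfl⟩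
  obtain ⟨Cmain, hCmain⟩ : ∃ c : ℝ, c = 9 * C₀ * C₁ * C₂ * max C₃ 1 * max C₄ 1 := ⟨_, rfl⟩
  obtain ⟨Crem, hCrem⟩ : ∃ c : ℝ, c = C₁ * C₂ * C₅ * C₆ * K₇ := ⟨_, rfl⟩
  obtain ⟨Csmall, hCsmall⟩ : ∃ c : ℝ, c = 36 * (4096 : ℝ) ^ (1 + a + b * (B + 2)) := ⟨_, rfl⟩
  have hCmain0 : 0 < Cmain := by rw [hCmain]; positivity
  have hCrem0 : 0 < Crem := by rw [hCrem]; positivity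
  have hCsmall0 : 0 < Csmall := by rw [hCsmall]; positivity
  refine ⟨Cmain + Crem + Csmall, by positivity, κ, ?_⟩
  intro x m h hx hm hh hmB hhB hmh w₁ w₂ hw₁ hw₁x hw₂ hw₂x
  obtain ⟨F, hF⟩ : ∃ F : ℝ, F = ((m : ℝ) / Nat.totient m) * ((h : ℝ) / Nat.totient h) := ⟨_, rfl⟩
  obtain ⟨L, hL⟩ : ∃ L : ℝ, L = Real.log w₁ * Real.log w₂ := ⟨_, rfl⟩
  obtain ⟨r₁, hr₁⟩ : ∃ r : ℝ, r = Real.log x / Real.log w₁ := ⟨_, rfl⟩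
  obtain ⟨r₂, hr₂⟩ : ∃ r : ℝ, r = Real.log x / Real.log w₂ := ⟨_, rfl⟩
  have hm0 : m ≠ 0 := by omega
  have hh0 : h ≠ 0 := by omega
  have hx0 : (0 : ℝ) < x := by exact_mod_cast (show 0 < x by omega)
  have hx2 : (2 : ℝ) ≤ x := by exact_mod_cast hx
  have hlogx : 0 < Real.log x := Real.log_pos (by linarith)
  have hlogw₁ : 0 < Real.log w₁ := Real.log_pos (by linarith)
  have hlogw₂ : 0 < Real.log w₂ := Real.log_pos (by linarith)
  have hlw₁x : Real.log w₁ ≤ Real.log x := Real.log_le_log (by linarith) hw₁x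
  have hlw₂x : Real.log w₂ ≤ Real.log x := Real.log_le_log (by linarith) hw₂x
  have hL0 : 0 < L := by rw [hL]; exact mul_pos hlogw₁ hlogw₂
  have hLx : L ≤ Real.log x ^ 2 := by
    rw [hL, sq]; exact mul_le_mul hlw₁x hlw₂x hlogw₂.le hlogx.le
  have hF1 : 1 ≤ F := by
    rw [hF]
    exact one_le_mul_of_one_le_of_one_le (one_le_self_div_totient hm0) (one_le_self_div_totient hh0)
  have hr₁1 : 1 ≤ r₁ := by rw [hr₁, le_div_iff₀ hlogw₁, one_mul]; exact hlw₁x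
  have hr₂1 : 1 ≤ r₂ := by rw [hr₂, le_div_iff₀ hlogw₂, one_mul]; exact hlw₂x
  have hrr1 : 1 ≤ r₁ ^ κ * r₂ ^ κ := one_le_mul_of_one_le_of_one_le (one_le_pow₀ hr₁1) (one_le_pow₀ hr₂1)
  -- `Φ = F x/L · r₁^κ r₂^κ ≥ x/(log x)²`
  obtain ⟨Φ, hΦ⟩ : ∃ Φ : ℝ, Φ = F * x / L * (r₁ ^ κ * r₂ ^ κ) := ⟨_, rfl⟩
  have hΦ0 : 0 < Φ := by rw [hΦ]; positivity
  have hΦx : (x : ℝ) / Real.log x ^ 2 ≤ Φ := by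
    rw [hΦ]
    calc (x : ℝ) / Real.log x ^ 2 ≤ (x : ℝ) / L := div_le_div_of_nonneg_left hx0.le hL0 hLx
      _ = 1 * x / L * 1 := by ring
      _ ≤ F * x / L * (r₁ ^ κ * r₂ ^ κ) := by
          refine mul_le_mul ?_ hrr1 zero_le_one (by positivity)
          exact div_le_div_of_nonneg_right (mul_le_mul_of_nonneg_right hF1 hx0.le) hL0.le
  have hfin : (Cmain + Crem + Csmall) * F * x / L * (r₁ ^ κ * r₂ ^ κ) =
      Cmain * Φ + Crem * Φ + Csmall * Φ := by rw [hΦ]; ring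
  rw [← hF, ← hL, ← hr₁, ← hr₂, hfin]
  have hmain0 : 0 ≤ Cmain * Φ := by positivity
  have hrem0 : 0 ≤ Crem * Φ := by positivity
  have hsmall0 : 0 ≤ Csmall * Φ := by positivity
  by_cases hxs : x < 4096
  · -- small `x`: trivial bounds
    have hxs' : (x : ℝ) < 4096 := by exact_mod_cast hxs
    set A := (Icc 1 x).filter (fun n : ℕ => Nat.Coprime n h ∧ (∀ p ∈ n.primeFactors, w₁ ≤ (p : ℝ)) ∧
      (∀ p ∈ (m * n + h).primeFactors, w₂ ≤ (p : ℝ))) with hA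
    have hterm : ∀ n ∈ A, ((n.divisors.card : ℝ)) ^ a * (((m * n + h).divisors.card : ℝ)) ^ b ≤
        (x : ℝ) ^ a * ((x : ℝ) ^ (B + 2)) ^ b := by
      intro n hn
      have hn' : n ∈ Icc 1 x := (Finset.mem_filter.mp hn).1
      rw [Finset.mem_Icc] at hn'
      have h1 : ((n.divisors.card : ℝ)) ≤ x := by
        exact_mod_cast (Nat.card_divisors_le_self n).trans hn'.2
      have h2 : (((m * n + h).divisors.card : ℝ)) ≤ (x : ℝ) ^ (B + 2) :=
        le_trans (by exact_mod_cast Nat.card_divisors_le_self (m * n + h)) (linear_le_pow hx hmB hhB hn'.2)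
      exact mul_le_mul (pow_le_pow_left₀ (Nat.cast_nonneg _) h1 a)
        (pow_le_pow_left₀ (Nat.cast_nonneg _) h2 b) (by positivity) (by positivity)
    have hAcard : (#A : ℝ) ≤ x := by
      have h1 : #A ≤ #(Icc 1 x) := Finset.card_filter_le _ _
      rw [Nat.card_Icc, Nat.add_sub_cancel] at h1
      exact_mod_cast h1
    have hS : ∑ n ∈ A, ((n.divisors.card : ℝ)) ^ a * (((m * n + h).divisors.card : ℝ)) ^ b ≤
        (4096 : ℝ) ^ (1 + a + b * (B + 2)) := by
      calc ∑ n ∈ A, ((n.divisors.card : ℝ)) ^ a * (((m * n + h).divisors.card : ℝ)) ^ b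
          ≤ ∑ n ∈ A, (x : ℝ) ^ a * ((x : ℝ) ^ (B + 2)) ^ b := Finset.sum_le_sum hterm
        _ = #A * ((x : ℝ) ^ a * ((x : ℝ) ^ (B + 2)) ^ b) := by rw [Finset.sum_const, nsmul_eq_mul]
        _ ≤ x * ((x : ℝ) ^ a * ((x : ℝ) ^ (B + 2)) ^ b) :=
            mul_le_mul_of_nonneg_right hAcard (by positivity)
        _ = (x : ℝ) ^ (1 + a + b * (B + 2)) := by ring
        _ ≤ (4096 : ℝ) ^ (1 + a + b * (B + 2)) := pow_le_pow_left₀ hx0.le hxs'.le _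
    have hl2 : Real.log 2 < 0.6931471808 := Real.log_two_lt_d9
    have hl2' : 0 < Real.log 2 := Real.log_pos one_lt_two
    have hlogx12 : Real.log x ≤ 12 * Real.log 2 := by
      have h1 := Real.log_le_log hx0 hxs'.le
      rw [show (4096 : ℝ) = 2 ^ 12 by norm_num, Real.log_pow] at h1
      push_cast at h1
      exact h1
    have hΦ36 : (1 : ℝ) / 36 ≤ Φ := by
      refine le_trans ?_ hΦx
      rw [div_le_div_iff₀ (by norm_num) (by positivity)]
      have h1 : Real.log x ^ 2 ≤ (12 * Real.log 2) ^ 2 := pow_le_pow_left₀ hlogx.le hlogx12 2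
      nlinarith [mul_pos hl2' (sub_pos.mpr hl2)]
    have hCs : (4096 : ℝ) ^ (1 + a + b * (B + 2)) ≤ Csmall * Φ := by
      rw [hCsmall]
      calc (4096 : ℝ) ^ (1 + a + b * (B + 2)) = 36 * (4096 : ℝ) ^ (1 + a + b * (B + 2)) * (1 / 36) := by
            ring
        _ ≤ 36 * (4096 : ℝ) ^ (1 + a + b * (B + 2)) * Φ := mul_le_mul_of_nonneg_left hΦ36 (by positivity)
    linarith
  · -- large `x`
    push Not at hxs
    have hlarge := sum_pow_card_divisors_le_of_large hC₀ hC₁ hC₂ hC₅.le hC₆.le HS hL₁ hL₂ hR₁ hR₂ hP₁ hP₂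
      hlog hxs hm hh hmB hhB hmh hw₁ hw₁x hw₂ hw₂x
    rw [← hF, ← hL, ← hr₁, ← hr₂, ← hCmain, ← hCrem] at hlarge
    have h1 : Cmain * F * x / L * (r₁ ^ 2 ^ (M₁ + 3) * r₂ ^ 2 ^ (M₂ + 3)) ≤ Cmain * Φ := by
      rw [hΦ]
      have e : Cmain * F * x / L * (r₁ ^ 2 ^ (M₁ + 3) * r₂ ^ 2 ^ (M₂ + 3)) =
          Cmain * (F * x / L) * (r₁ ^ 2 ^ (M₁ + 3) * r₂ ^ 2 ^ (M₂ + 3)) := by ring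
      have e' : Cmain * (F * x / L * (r₁ ^ κ * r₂ ^ κ)) = Cmain * (F * x / L) * (r₁ ^ κ * r₂ ^ κ) := by ring
      rw [e, e']
      refine mul_le_mul_of_nonneg_left ?_ (by positivity)
      refine mul_le_mul (pow_le_pow_right₀ hr₁1 ?_) (pow_le_pow_right₀ hr₂1 ?_) (by positivity)
        (by positivity)
      · rw [hκ]; exact Nat.le_add_right _ _
      · rw [hκ]; exact Nat.le_add_left _ _
    have h2 : Crem * ((x : ℝ) / Real.log x ^ 2) ≤ Crem * Φ := mul_le_mul_of_nonneg_left hΦx hCrem0.le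
    linarith


end PairDivisorSums

end Literature.NumberTheory.Sieve
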